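import Literature.Barriers.Parity.SiegelZeroPrimePairsSieveMainTerm
import HarnessLib

/-!
# Matomäki–Merikoski, Lemma 3.3: the composite sum of the `β`-sieve weights with a coprimality condition

Sibling of `Literature/Barriers/Parity/SiegelZeroPrimePairs.lean` (the catalogue entry vendoring
Matomäki–Merikoski, *Siegel zeros, twin primes, Goldbach's conjecture, and primes in short
intervals* (IMRN 2023; arXiv:2112.11412), Theorem 1.3 as the named fact
`Literature.Barriers.Parity.MatomakiMerikoski2023_pairCorrelation`) and of
`SiegelZeroPrimePairsSieveWeights.lean` / `SiegelZeroPrimePairsSieveMainTerm.lean` (Lemma 3.2 (i)/(ii)).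
Lemma 3.3 of the source evaluates `∑_{d₁,d₂ ∣ P(z), (d₂, d₁v) = 1, (d₁d₂, q) = 1} λ_{d₁}λ_{d₂}/(d₁d₂)`
for the upper `β`-sieve weights `λ_d = μ(d) 1_{d ∈ 𝒟}` (= `μ(d) · BetaSieve.ind 1 β D d`) — the
sieve main term of Proposition 2.3 ((5.5) in §5.1, with `v = h m₁`). Everything here is a theorem
(no definition, no named fact):

* `MatomakiMerikoski.abs_compositeSieveSum_sub_le` — the estimate for a general squarefree sifting
  range `P` with prime factors `< z`: relative error `C(β, A) e^{−As/2}` (`s = log D/log z`)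
  against `M = ∏_{p ∣ P, p ∤ q}(1 − 1/p) ∏_{p ∣ P, p ∤ vq}(1 − 1/(p − 1))`, for `A ≥ 1`,
  `β ≥ 2 + 6(6 + 2^{A+2})/A`, under the hypothesis `2 ∣ P → 2 ∣ vq` (see below);
* `MatomakiMerikoski2023_lemma33` — **Lemma 3.3** in the source's parametrisation (`P = P(z)`,
  `D = X^θ`, `z = X^{1/u}`, error `C(β,A) e^{−Aθu/2}`), with the extra hypothesis `2 ∣ vq`.

Proof as printed (§3.2): the inner sum over `d₁` is expanded EXACTLY by the main-term identity with
the density `g(d) = 1_{(d, d₂q) = 1}/d` ((eq:lamd/d); the tree's `BetaSieve.mainTerm_identity`); its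
main part contributes `∏_{p<z,p∤q}(1 − 1/p) ∑_{d₂} λ_{d₂} 1_{(d₂,vq)=1}/φ(d₂)`
(`MatomakiMerikoski.main_factor_eq`), evaluated by Lemma 3.2 (ii)
(`MatomakiMerikoski.abs_upperSieveSum_sub_vprod_le` with `g = 1_{(d,vq)=1}/φ`); the boundary part,
summed over `d₂` first, becomes `∑_t μ(t) χ̄(t) 1_{(t,q)=1} t⁻¹ W(t) ∑_{d₂} λ_{d₂} g_t(d₂)` with
`g_t(d) = 1_{(d,vqt)=1} (1/d) ∏_{p ∣ d, p < q(t)}(1 − 1/p)⁻¹` (`MatomakiMerikoski.bdry_factor_eq`;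
the source's "`∑_{d₂ ∣ P(z), (d₂, vqmp_r) = 1} (λ_{d₂}/d₂) ∏_{p < p_r, p ∣ d₂}(1 − 1/p)⁻¹`"), where
Lemma 3.2 (ii) for `g_t`, the product comparisons `U_t ≤ e³ V₃ ∏_{p ∣ t}(1 + 3/p)` and
`W(t) ≤ V_q ∏_{p ≥ z_r}(1 + 6/p)` (`MatomakiMerikoski.vprod_Gt_le`, `MatomakiMerikoski.W_le`,
`MatomakiMerikoski.lemma33_bdry_term_le`), the weighted count of the boundary terms of index `r`
(`MatomakiMerikoski.sum_bdry_fiber_weight_le`: "`2^{A(ω(m)−r)} ≥ 1/2^A`"), Mertens in windows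
(`MatomakiMerikoski.prod_one_add_div_le_pow`) and the geometric tail
(`MatomakiMerikoski.sum_geometric_window_le`) finish the proof. The multiplicative densities are
produced by `MatomakiMerikoski.exists_mulFn` (`F(d) = 1_{(d,m)=1} ∏_{p ∣ d} a(p)`), so that no
definition is introduced.

Deviation from the printed statement (recorded, not hidden): the source states Lemma 3.3 for all
`v, q ∈ ℕ`, but for odd `vq` (and `z > 2`) the right-hand side vanishes (`1 − 1/φ(2) = 0`) while
the left-hand side does not, so the relative-error statement as printed is false there; the
theorems here assume `2 ∣ P → 2 ∣ vq` (resp. `2 ∣ vq`), which holds in the source's only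
application ((5.5), `v = h m₁` with `h` even — "Theorems 1.3 and 1.4 are trivial unless `h` is
even", §7). Constants are explicit but not optimised.

## References

* K. Matomäki, J. Merikoski, *Siegel zeros, twin primes, Goldbach's conjecture, and primes in
  short intervals*, IMRN 2023:23, 20337–20384 (arXiv:2112.11412): §3.2, Lemma 3.3 and its proof
  ((eq:lamd/d), (eq:SieveCombClaim)), §5.1 (5.5) (read in the held text, `lit read
  arxiv:2112.11412`, chunks p0010–p0011, p0016–p0017). [cite: MatomakiMerikoski2023, Lemma 3.3]
* G. Greaves, *Sieves in Number Theory*, Springer 2001, §3.1.2 ((2.15)–(2.16)), §3.3.3–§3.3.4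
  (the tree's `SieveFrameworkFundamentalLemma.lean`). [cite: Greaves2001, §3.3]
* J. Friedlander, H. Iwaniec, *Opera de Cribro*, AMS Colloquium Publ. 57 (2010), §6.5 (the source's
  [Opera], "see also [Opera]" for the condition `(d₁, d₂) = 1`). [cite: FriedlanderIwaniecOpera2010, §6.5]
-/

noncomputable section

open Finset
open scoped ArithmeticFunction.Moebius

namespace Literature.Barriers.Parity.MatomakiMerikoski

open Literature.NumberTheory.Sieve Literature.NumberTheory.Sieve.BetaSieve

/-! ### Squarefree-supported multiplicative functions from prime values -/

/-- For prime values `a : ℕ → ℝ` and a modulus `m`, there is a multiplicative arithmetic function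
`F` with `F(d) = 1_{(d, m) = 1} ∏_{p ∣ d} a(p)` for `d ≥ 1` (so `F(d) = 1_{(d,m)=1} ∏_{p ∣ d} a(p)`
is the multiplicative function with `F(p) = a(p) 1_{p ∤ m}` on squarefree `d`). [folklore] -/
theorem exists_mulFn (a : ℕ → ℝ) (m : ℕ) :
    ∃ F : ArithmeticFunction ℝ, F.IsMultiplicative ∧
      ∀ d : ℕ, d ≠ 0 → F d = if d.Coprime m then ∏ p ∈ d.primeFactors, a p else 0 := by
  classical
  refine ⟨⟨fun d => if d = 0 then 0 else if d.Coprime m then ∏ p ∈ d.primeFactors, a p else 0,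
    if_pos rfl⟩, ?_, fun d hd => by simp [hd]⟩
  refine ⟨by simp, fun {d e} hde => ?_⟩
  simp only [ArithmeticFunction.coe_mk]
  rcases Nat.eq_zero_or_pos d with rfl | hd
  · simp
  rcases Nat.eq_zero_or_pos e with rfl | he
  · simp
  rw [if_neg (Nat.mul_ne_zero hd.ne' he.ne'), if_neg hd.ne', if_neg he.ne']
  by_cases hdm : d.Coprime m
  · by_cases hem : e.Coprime m
    · rw [if_pos (Nat.Coprime.mul_left hdm hem), if_pos hdm, if_pos hem, hde.primeFactors_mul,
        Finset.prod_union hde.disjoint_primeFactors]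
    · rw [if_neg hem, mul_zero, if_neg]
      exact fun h => hem (Nat.Coprime.coprime_mul_left h)
  · rw [if_neg hdm, zero_mul, if_neg]
    exact fun h => hdm (Nat.Coprime.coprime_mul_right h)

/-! ### Boundary terms of a given index: structure and weighted count -/

/-- For multiplicative `w` and squarefree `Q`: `∑_{d ∣ Q} 2^{Aω(d)} w(d) = ∏_{p ∣ Q} (1 + 2^A w(p))`.
[cite: MatomakiMerikoski2023, Lemma 3.2 (ii) (proof)] -/
theorem sum_divisors_two_pow_mul_eq {w : ArithmeticFunction ℝ} (hwm : w.IsMultiplicative) {Q : ℕ}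
    (hQ : Squarefree Q) (A : ℕ) :
    ∑ d ∈ Q.divisors, (2 : ℝ) ^ (A * d.primeFactors.card) * w d =
      ∏ p ∈ Q.primeFactors, (1 + (2 : ℝ) ^ A * w p) := by
  let f : ArithmeticFunction ℝ := ⟨fun d => (2 : ℝ) ^ (A * d.primeFactors.card) * w d, by simp⟩
  have hf_apply : ∀ d, f d = (2 : ℝ) ^ (A * d.primeFactors.card) * w d := fun d => rfl
  have hfm : f.IsMultiplicative := by
    refine ⟨by simp [hf_apply, hwm.map_one], fun {a b} hab => ?_⟩
    simp only [hf_apply]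
    rw [card_primeFactors_mul_of_coprime hab, hwm.map_mul_of_coprime hab, mul_add, pow_add]
    ring
  have h := hfm.prodPrimeFactors_one_add_of_squarefree hQ
  simp only [hf_apply] at h
  rw [← h]
  refine Finset.prod_congr rfl fun p hp => ?_
  rw [(Nat.prime_of_mem_primeFactors hp).primeFactors, Finset.card_singleton, mul_one]

/-- **Structure of a boundary term of index `r`** (upper sieve): if `t ∣ P` (squarefree `P` with
prime factors `< z`, `1 < z`, `1 < β`, `1 < D`, `z^β ≤ D`) has `χ̄⁺(t) ≠ 0` and `ν(t) = r`, then `t`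
is squarefree, `q(t) ≥ z_r = z^{(1−1/β)^r}`, all prime factors of `t` are `≥ z_r`, and
`log D < (r + β) log z` (the tree's `BetaSieve.bdry_props`).
[cite: MatomakiMerikoski2023, Lemma 3.2 (proof: "`p_r ≥ z_r`", "only if `r ≥ uθ − β`")] -/
theorem bdry_fiber_props {P : ℕ} (hP : Squarefree P) {z β D : ℝ} (hβ : 1 < β) (hz : 1 < z)
    (hD1 : 1 < D) (hzD : β * Real.log z ≤ Real.log D) (hPz : ∀ p ∈ P.primeFactors, (p : ℝ) < z)
    {r t : ℕ} (ht : t ∈ P.divisors.filter (fun t => bdry 1 β D t ≠ 0 ∧ t.primeFactors.card = r)) :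
    Squarefree t ∧ t ≠ 1 ∧ z ^ ((1 - 1 / β) ^ r) ≤ (t.minFac : ℝ) ∧
      t.primeFactors ⊆ P.primeFactors.filter (fun p : ℕ => z ^ ((1 - 1 / β) ^ r) ≤ (p : ℝ)) ∧
      Real.log D < ((r : ℝ) + β) * Real.log z := by
  have hz0 : 0 < z := by linarith
  rw [Finset.mem_filter] at ht
  obtain ⟨htP, hb, hcard⟩ := ht
  have htP' := Nat.dvd_of_mem_divisors htP
  have hsq : Squarefree t := hP.squarefree_of_dvd htP'
  have hpz : ∀ p ∈ t.primeFactors, (p : ℝ) < z := fun p hp =>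
    hPz p (Nat.primeFactors_mono htP' hP.ne_zero hp)
  obtain ⟨-, h', h⟩ := bdry_ne_zero_props hb
  obtain ⟨hlogq, hidx⟩ := bdry_props (par := 1) hβ hz hD1 hzD hsq hpz h' h
  have ht1 : t ≠ 1 := fun h1 => h (pred_of_le_one h1.le)
  have hq := Nat.minFac_prime ht1
  have hq0 : (0 : ℝ) < t.minFac := by exact_mod_cast hq.pos
  rw [hcard] at hlogq hidx
  have hzrq : z ^ ((1 - 1 / β) ^ r) ≤ (t.minFac : ℝ) := by
    rw [Real.rpow_def_of_pos hz0, ← Real.exp_log hq0]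
    exact Real.exp_le_exp.mpr (by rw [mul_comm]; exact hlogq)
  refine ⟨hsq, ht1, hzrq, fun p hp => ?_, hidx⟩
  rw [Finset.mem_filter]
  refine ⟨Nat.primeFactors_mono htP' hP.ne_zero hp, hzrq.trans ?_⟩
  exact_mod_cast Nat.minFac_le_of_dvd (Nat.prime_of_mem_primeFactors hp).two_le
    (Nat.dvd_of_mem_primeFactors hp)

/-- **Weighted count of the boundary terms of index `r`**: for a non-negative multiplicative `w`,
`∑_{t ∣ P boundary, ν(t) = r} w(t) ≤ 2^{−Ar} ∏_{p ∣ P, p ≥ z_r} (1 + 2^A w(p))` (the source's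
"`≤ ∑_m 2^{A(ω(m)−r)} |μ(m)| g(m)`" device). [cite: MatomakiMerikoski2023, Lemma 3.2 (ii) (proof)] -/
theorem sum_bdry_fiber_weight_le {P : ℕ} (hP : Squarefree P) {z β D : ℝ} (hβ : 1 < β) (hz : 1 < z)
    (hD1 : 1 < D) (hzD : β * Real.log z ≤ Real.log D) (hPz : ∀ p ∈ P.primeFactors, (p : ℝ) < z)
    {w : ArithmeticFunction ℝ} (hwm : w.IsMultiplicative) (hw0 : ∀ d, 0 ≤ w d) (A r : ℕ) :
    ∑ t ∈ P.divisors.filter (fun t => bdry 1 β D t ≠ 0 ∧ t.primeFactors.card = r), w t ≤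
      (∏ p ∈ P.primeFactors.filter (fun p : ℕ => z ^ ((1 - 1 / β) ^ r) ≤ (p : ℝ)),
        (1 + (2 : ℝ) ^ A * w p)) / (2 : ℝ) ^ (A * r) := by
  classical
  set S := P.primeFactors.filter (fun p : ℕ => z ^ ((1 - 1 / β) ^ r) ≤ (p : ℝ)) with hS
  set F := P.divisors.filter (fun t => bdry 1 β D t ≠ 0 ∧ t.primeFactors.card = r) with hF
  set Q : ℕ := ∏ p ∈ S, p with hQ
  have hSprime : ∀ p ∈ S, p.Prime := fun p hp =>
    Nat.prime_of_mem_primeFactors (Finset.mem_filter.mp hp).1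
  have hQP : Q ∣ P := by
    conv_rhs => rw [← Nat.prod_primeFactors_of_squarefree hP]
    exact Finset.prod_dvd_prod_of_subset _ _ _ (Finset.filter_subset _ _)
  have hQsq : Squarefree Q := hP.squarefree_of_dvd hQP
  have hQpf : Q.primeFactors = S := Nat.primeFactors_prod hSprime
  have hFQ : F ⊆ Q.divisors := by
    intro t ht
    obtain ⟨hsq, -, -, hsub, -⟩ := bdry_fiber_props hP hβ hz hD1 hzD hPz ht
    rw [Nat.mem_divisors]
    refine ⟨?_, hQsq.ne_zero⟩
    conv_lhs => rw [← Nat.prod_primeFactors_of_squarefree hsq]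
    exact Finset.prod_dvd_prod_of_subset _ _ _ hsub
  have h2 : (0 : ℝ) < (2 : ℝ) ^ (A * r) := by positivity
  rw [le_div_iff₀ h2, ← hQpf, ← sum_divisors_two_pow_mul_eq hwm hQsq A, Finset.sum_mul]
  calc ∑ t ∈ F, w t * (2 : ℝ) ^ (A * r)
      = ∑ t ∈ F, (2 : ℝ) ^ (A * t.primeFactors.card) * w t := by
        refine Finset.sum_congr rfl fun t ht => ?_
        rw [(Finset.mem_filter.mp ht).2.2, mul_comm]
    _ ≤ ∑ d ∈ Q.divisors, (2 : ℝ) ^ (A * d.primeFactors.card) * w d :=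
        Finset.sum_le_sum_of_subset_of_nonneg hFQ fun d _ _ => by
          exact mul_nonneg (by positivity) (hw0 d)

/-! ### Lemma 3.3: the algebra of the two Euler-product manipulations -/

/-- For a prime `p`: `(p, m) = 1 ↔ p ∤ m`, and the value of a "`mulFn`" at `p`. [folklore] -/
theorem mulFn_prime {F : ArithmeticFunction ℝ} {a : ℕ → ℝ} {m : ℕ}
    (hF : ∀ d : ℕ, d ≠ 0 → F d = if d.Coprime m then ∏ p ∈ d.primeFactors, a p else 0)
    {p : ℕ} (hp : p.Prime) : F p = if ¬ p ∣ m then a p else 0 := by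
  rw [hF p hp.ne_zero, hp.primeFactors, Finset.prod_singleton]
  by_cases h : p ∣ m
  · rw [if_neg (fun hc => ?_), if_neg (not_not.mpr h)]
    exact hp.one_lt.ne' (Nat.Coprime.eq_one_of_dvd hc h)
  · rw [if_pos ((Nat.Prime.coprime_iff_not_dvd hp).mpr h), if_pos h]

/-- `1/d = ∏_{p ∣ d} 1/p` for squarefree `d` (in `ℝ`). [folklore] -/
theorem one_div_eq_prod_of_squarefree {d : ℕ} (hd : Squarefree d) :
    1 / (d : ℝ) = ∏ p ∈ d.primeFactors, 1 / (p : ℝ) := by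
  conv_lhs => rw [← Nat.prod_primeFactors_of_squarefree hd]
  push_cast
  rw [one_div, ← Finset.prod_inv_distrib]
  simp [one_div]

/-- **The main-term manipulation of Lemma 3.3** ("the first term on the right hand side contributes
… `∑_{d₂} λ_{d₂}/d₂ ∏_{p<z, p∤d₂q}(1 − 1/p) = ∏_{p<z,p∤q}(1 − 1/p) ∑_{d₂} λ_{d₂}/φ(d₂)`"): for a
divisor `d₂` of the squarefree `P` with `(d₂, vq) = 1`,
`(1/d₂) ∏_{p ∣ P, p ∤ d₂ q}(1 − 1/p) = ∏_{p ∣ P, p ∤ q}(1 − 1/p) · 1_{(d₂,vq)=1}/φ(d₂)`, with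
`1/φ(d₂) = ∏_{p ∣ d₂} 1/(p − 1)`. [cite: MatomakiMerikoski2023, Lemma 3.3 (proof)] -/
theorem main_factor_eq {P : ℕ} (hP : Squarefree P) {q v d₂ : ℕ} (hd₂ : d₂ ∈ P.divisors)
    (hcop : d₂.Coprime (v * q)) {G₂ : ArithmeticFunction ℝ}
    (hG₂ : ∀ d : ℕ, d ≠ 0 → G₂ d = if d.Coprime (d₂ * q) then ∏ p ∈ d.primeFactors, 1 / (p : ℝ) else 0)
    {G₃ : ArithmeticFunction ℝ}
    (hG₃ : ∀ d : ℕ, d ≠ 0 → G₃ d = if d.Coprime (v * q) then ∏ p ∈ d.primeFactors, 1 / ((p : ℝ) - 1) else 0) :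
    1 / (d₂ : ℝ) * vprod G₂ P =
      (∏ p ∈ P.primeFactors.filter (fun p => ¬ p ∣ q), (1 - 1 / (p : ℝ))) * G₃ d₂ := by
  classical
  have hd₂P : d₂ ∣ P := Nat.dvd_of_mem_divisors hd₂
  have hd₂0 : d₂ ≠ 0 := (Nat.mem_divisors.mp hd₂).2 |> fun hP0 h0 => hP0 (by
    rw [h0] at hd₂P; exact Nat.eq_zero_of_zero_dvd hd₂P)
  have hsq : Squarefree d₂ := hP.squarefree_of_dvd hd₂P
  have hcopq : d₂.Coprime q := Nat.Coprime.coprime_mul_left_right hcop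
  -- `vprod G₂ P = ∏_{p ∣ P, p ∤ q, p ∤ d₂} (1 − 1/p)`
  set T := P.primeFactors.filter (fun p => ¬ p ∣ q) with hT
  have hV : vprod G₂ P = ∏ p ∈ T.filter (fun p => p ∉ d₂.primeFactors), (1 - 1 / (p : ℝ)) := by
    rw [vprod, hT, Finset.filter_filter, Finset.prod_filter]
    refine Finset.prod_congr rfl fun p hp => ?_
    have hp' := Nat.prime_of_mem_primeFactors hp
    rw [mulFn_prime hG₂ hp']
    have hiff : ¬ p ∣ d₂ * q ↔ ¬ p ∣ q ∧ p ∉ d₂.primeFactors := by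
      rw [hp'.dvd_mul, not_or, Nat.mem_primeFactors]
      constructor
      · rintro ⟨h1, h2⟩; exact ⟨h2, fun h => h1 h.2.1⟩
      · rintro ⟨h1, h2⟩; exact ⟨fun h => h2 ⟨hp', h, hd₂0⟩, h1⟩
    by_cases h : ¬ p ∣ d₂ * q
    · rw [if_pos h, if_pos (hiff.mp h)]
    · rw [if_neg h, if_neg (fun h' => h (hiff.mpr h')), sub_zero]
  -- `pf d₂ ⊆ T` and the splitting of `∏_T`
  have hsub : d₂.primeFactors ⊆ T := by
    intro p hp
    rw [hT, Finset.mem_filter]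
    refine ⟨Nat.primeFactors_mono hd₂P hP.ne_zero hp, fun hpq => ?_⟩
    have hp' := Nat.prime_of_mem_primeFactors hp
    exact hp'.one_lt.ne' (Nat.eq_one_of_dvd_coprimes hcopq (Nat.dvd_of_mem_primeFactors hp) hpq)
  have hsplit : ∏ p ∈ T, (1 - 1 / (p : ℝ)) =
      (∏ p ∈ d₂.primeFactors, (1 - 1 / (p : ℝ))) * ∏ p ∈ T.filter (fun p => p ∉ d₂.primeFactors), (1 - 1 / (p : ℝ)) := by
    rw [← Finset.prod_filter_mul_prod_filter_not T (fun p => p ∈ d₂.primeFactors)]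
    congr 1
    refine Finset.prod_congr ?_ fun _ _ => rfl
    ext p
    rw [Finset.mem_filter]
    exact ⟨fun h => h.2, fun h => ⟨hsub h, h⟩⟩
  have hG₃d : G₃ d₂ = ∏ p ∈ d₂.primeFactors, 1 / ((p : ℝ) - 1) := by
    rw [hG₃ d₂ hd₂0, if_pos hcop]
  rw [hV, hsplit, hG₃d, one_div_eq_prod_of_squarefree hsq]
  -- termwise: `1/p = (1 − 1/p) · 1/(p − 1)`
  have hterm : ∏ p ∈ d₂.primeFactors, 1 / (p : ℝ) =
      (∏ p ∈ d₂.primeFactors, (1 - 1 / (p : ℝ))) * ∏ p ∈ d₂.primeFactors, 1 / ((p : ℝ) - 1) := by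
    rw [← Finset.prod_mul_distrib]
    refine Finset.prod_congr rfl fun p hp => ?_
    have hp2 : (2 : ℝ) ≤ p := by exact_mod_cast (Nat.prime_of_mem_primeFactors hp).two_le
    have hp1 : (p : ℝ) - 1 ≠ 0 := by linarith
    have hp0 : (p : ℝ) ≠ 0 := by linarith
    field_simp
  rw [hterm]
  ring

/-- **The boundary-term manipulation of Lemma 3.3**: for a boundary `t ∣ P` (squarefree) and a
divisor `d₂ ∣ P` with `(d₂, vq) = 1`, the summand
`(λ_{d₂}/d₂) · g_{d₂}(t) · V_{g_{d₂}}(P; q(t))` (`g_{d₂}(d) = 1_{(d, d₂q)=1}/d`) equals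
`1_{(t,q)=1} (1/t) ∏_{p ∣ P, p < q(t), p ∤ q}(1 − 1/p) · λ_{d₂} g_t(d₂)` with
`g_t(d) = 1_{(d, vqt)=1} ∏_{p ∣ d} w_t(p)`, `w_t(p) = 1/(p−1)` (`p < q(t)`), `1/p` (`p ≥ q(t)`)
("`∑_{d₂ ∣ P(z), (d₂, vqmp_r)=1} (λ_{d₂}/d₂) ∏_{p<p_r, p ∣ d₂}(1 − 1/p)^{-1}`").
[cite: MatomakiMerikoski2023, Lemma 3.3 (proof)] -/
theorem bdry_factor_eq {P : ℕ} (hP : Squarefree P) {q v d₂ t : ℕ} (hd₂ : d₂ ∈ P.divisors)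
    (hcop : d₂.Coprime (v * q)) (ht : t ∈ P.divisors) {G₂ : ArithmeticFunction ℝ}
    (hG₂ : ∀ d : ℕ, d ≠ 0 → G₂ d = if d.Coprime (d₂ * q) then ∏ p ∈ d.primeFactors, 1 / (p : ℝ) else 0)
    {Gt : ArithmeticFunction ℝ}
    (hGt : ∀ d : ℕ, d ≠ 0 → Gt d = if d.Coprime (v * q * t) then
      ∏ p ∈ d.primeFactors, (if p < t.minFac then 1 / ((p : ℝ) - 1) else 1 / (p : ℝ)) else 0)
    (lam : ℝ) :
    lam / (d₂ : ℝ) * G₂ t * vlt G₂ P t.minFac =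
      (if t.Coprime q then 1 / (t : ℝ) *
          ∏ p ∈ P.primeFactors.filter (fun p => p < t.minFac ∧ ¬ p ∣ q), (1 - 1 / (p : ℝ)) else 0) *
        (lam * Gt d₂) := by
  classical
  have hd₂P : d₂ ∣ P := Nat.dvd_of_mem_divisors hd₂
  have hP0 : P ≠ 0 := hP.ne_zero
  have hd₂0 : d₂ ≠ 0 := fun h0 => hP0 (Nat.eq_zero_of_zero_dvd (h0 ▸ hd₂P))
  have htP : t ∣ P := Nat.dvd_of_mem_divisors ht
  have ht0 : t ≠ 0 := fun h0 => hP0 (Nat.eq_zero_of_zero_dvd (h0 ▸ htP))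
  have hsq₂ : Squarefree d₂ := hP.squarefree_of_dvd hd₂P
  have hsqt : Squarefree t := hP.squarefree_of_dvd htP
  have hcopq : d₂.Coprime q := Nat.Coprime.coprime_mul_left_right hcop
  -- the vanishing cases
  by_cases htq : t.Coprime q
  swap
  · rw [if_neg htq, zero_mul]
    have : G₂ t = 0 := by
      rw [hG₂ t ht0, if_neg]
      exact fun h => htq (Nat.Coprime.coprime_mul_left_right h)
    rw [this]; ring
  rw [if_pos htq]
  by_cases htd : t.Coprime d₂
  swap
  · have h1 : G₂ t = 0 := by
      rw [hG₂ t ht0, if_neg]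
      exact fun h => htd (Nat.Coprime.coprime_mul_right_right h)
    have h2 : Gt d₂ = 0 := by
      rw [hGt d₂ hd₂0, if_neg]
      exact fun h => htd (Nat.Coprime.coprime_mul_left_right h).symm
    rw [h1, h2]; ring
  -- the main case `(t, d₂ q) = 1`
  have htd₂q : t.Coprime (d₂ * q) := Nat.Coprime.mul_right htd htq
  have hd₂t : d₂.Coprime (v * q * t) := Nat.Coprime.mul_right hcop htd.symm
  have hG₂t : G₂ t = 1 / (t : ℝ) := by
    rw [hG₂ t ht0, if_pos htd₂q, one_div_eq_prod_of_squarefree hsqt]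
  have hGtd : Gt d₂ = ∏ p ∈ d₂.primeFactors, (if p < t.minFac then 1 / ((p : ℝ) - 1) else 1 / (p : ℝ)) := by
    rw [hGt d₂ hd₂0, if_pos hd₂t]
  -- `vlt G₂ P q(t) = ∏_{p ∣ P, p < q(t), p ∤ q, p ∉ pf d₂} (1 − 1/p)`
  set T := P.primeFactors.filter (fun p => p < t.minFac ∧ ¬ p ∣ q) with hT
  have hVlt : vlt G₂ P t.minFac = ∏ p ∈ T.filter (fun p => p ∉ d₂.primeFactors), (1 - 1 / (p : ℝ)) := by
    rw [vlt, hT, Finset.filter_filter, Finset.prod_filter, Finset.prod_filter]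
    refine Finset.prod_congr rfl fun p hp => ?_
    have hp' := Nat.prime_of_mem_primeFactors hp
    rw [mulFn_prime hG₂ hp']
    have hiff : ¬ p ∣ d₂ * q ↔ ¬ p ∣ q ∧ p ∉ d₂.primeFactors := by
      rw [hp'.dvd_mul, not_or, Nat.mem_primeFactors]
      constructor
      · rintro ⟨h1, h2⟩; exact ⟨h2, fun h => h1 h.2.1⟩
      · rintro ⟨h1, h2⟩; exact ⟨fun h => h2 ⟨hp', h, hd₂0⟩, h1⟩
    by_cases hlt : p < t.minFac
    · rw [if_pos hlt]
      by_cases h : ¬ p ∣ d₂ * q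
      · rw [if_pos h, if_pos ⟨⟨hlt, (hiff.mp h).1⟩, (hiff.mp h).2⟩]
      · rw [if_neg h, sub_zero, if_neg (fun h' => h (hiff.mpr ⟨h'.1.2, h'.2⟩))]
    · rw [if_neg hlt, if_neg (fun h' => hlt h'.1.1)]
  have hsub : d₂.primeFactors.filter (fun p => p < t.minFac) ⊆ T := by
    intro p hp
    rw [Finset.mem_filter] at hp
    rw [hT, Finset.mem_filter]
    refine ⟨Nat.primeFactors_mono hd₂P hP0 hp.1, hp.2, fun hpq => ?_⟩
    have hp' := Nat.prime_of_mem_primeFactors hp.1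
    exact hp'.one_lt.ne' (Nat.eq_one_of_dvd_coprimes hcopq (Nat.dvd_of_mem_primeFactors hp.1) hpq)
  have hseteq : T.filter (fun p => p ∈ d₂.primeFactors) =
      d₂.primeFactors.filter (fun p => p < t.minFac) := by
    apply Finset.Subset.antisymm
    · intro p hp
      have hp' := Finset.mem_filter.mp hp
      have hpT := Finset.mem_filter.mp hp'.1
      exact Finset.mem_filter.mpr ⟨hp'.2, hpT.2.1⟩
    · intro p hp
      have hp' := Finset.mem_filter.mp hp
      exact Finset.mem_filter.mpr ⟨hsub hp, hp'.1⟩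
  have hsplit : ∏ p ∈ T, (1 - 1 / (p : ℝ)) =
      (∏ p ∈ d₂.primeFactors.filter (fun p => p < t.minFac), (1 - 1 / (p : ℝ))) *
        ∏ p ∈ T.filter (fun p => p ∉ d₂.primeFactors), (1 - 1 / (p : ℝ)) := by
    rw [← Finset.prod_filter_mul_prod_filter_not T (fun p => p ∈ d₂.primeFactors), hseteq]
  rw [hVlt, hG₂t, hsplit, hGtd, div_eq_mul_one_div lam, one_div_eq_prod_of_squarefree hsq₂]
  -- `∏_{pf d₂} 1/p = ∏_{pf d₂, p<q(t)} (1 − 1/p) · ∏_{pf d₂} w_t(p)`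
  have hkey : ∏ p ∈ d₂.primeFactors, 1 / (p : ℝ) =
      (∏ p ∈ d₂.primeFactors.filter (fun p => p < t.minFac), (1 - 1 / (p : ℝ))) *
        ∏ p ∈ d₂.primeFactors, (if p < t.minFac then 1 / ((p : ℝ) - 1) else 1 / (p : ℝ)) := by
    rw [Finset.prod_filter, ← Finset.prod_mul_distrib]
    refine Finset.prod_congr rfl fun p hp => ?_
    have hp2 : (2 : ℝ) ≤ p := by exact_mod_cast (Nat.prime_of_mem_primeFactors hp).two_le
    have hp1 : (p : ℝ) - 1 ≠ 0 := by linarith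
    have hp0 : (p : ℝ) ≠ 0 := by linarith
    split_ifs
    · field_simp
    · ring
  rw [hkey]
  ring

/-! ### Lemma 3.3: comparison of the Euler products -/

/-- `∏_{p ∣ P} (1 + 3/p²) ≤ e³`. [folklore] -/
theorem prod_one_add_three_div_sq_le (P : ℕ) :
    ∏ p ∈ P.primeFactors, (1 + 3 / (p : ℝ) ^ 2) ≤ Real.exp 3 := by
  have hsub : P.primeFactors ⊆ Finset.Icc 2 P := by
    intro p hp
    have hp' := Nat.prime_of_mem_primeFactors hp
    exact Finset.mem_Icc.mpr ⟨hp'.two_le, Nat.le_of_dvd (Nat.pos_of_ne_zero (Nat.mem_primeFactors.mp hp).2.2)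
      (Nat.dvd_of_mem_primeFactors hp)⟩
  have hsum : ∑ p ∈ P.primeFactors, (1 : ℝ) / (p : ℝ) ^ 2 ≤ 1 :=
    calc ∑ p ∈ P.primeFactors, (1 : ℝ) / (p : ℝ) ^ 2 ≤ ∑ p ∈ Finset.Icc 2 P, (1 : ℝ) / (p : ℝ) ^ 2 :=
          Finset.sum_le_sum_of_subset_of_nonneg hsub fun p _ _ => by positivity
      _ ≤ 2 / (2 : ℕ) := sum_Icc_inv_sq_le le_rfl
      _ = 1 := by norm_num
  calc ∏ p ∈ P.primeFactors, (1 + 3 / (p : ℝ) ^ 2)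
      ≤ ∏ p ∈ P.primeFactors, Real.exp (3 / (p : ℝ) ^ 2) :=
        Finset.prod_le_prod (fun p _ => by positivity) fun p _ => by
          rw [add_comm]; exact Real.add_one_le_exp _
    _ = Real.exp (3 * ∑ p ∈ P.primeFactors, (1 : ℝ) / (p : ℝ) ^ 2) := by
        rw [← Real.exp_sum, Finset.mul_sum]
        congr 1; refine Finset.sum_congr rfl fun p _ => ?_; ring
    _ ≤ Real.exp 3 := Real.exp_le_exp.mpr (by nlinarith)

/-- **`U_t ≤ e³ V₃ ∏_{p ∣ t}(1 + 3/p)`**: the main term of the inner sieve at a boundary `t`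
(density `g_t`) against the target product `V₃ = ∏_{p ∣ P, p ∤ vq}(1 − 1/φ(p))` (factor by factor:
`(p−1)/(p−2) ≤ 1 + 3/p` at `p ∣ t`, `(p−1)²/(p(p−2)) ≤ 1 + 3/p²` at `p ≥ q(t)`, all `p ≥ 3`).
[cite: MatomakiMerikoski2023, Lemma 3.3 (proof)] -/
theorem vprod_Gt_le {P : ℕ} (hP : Squarefree P) {q v t : ℕ} (ht : t ∈ P.divisors)
    (h2 : 2 ∈ P.primeFactors → 2 ∣ v * q) {G₃ : ArithmeticFunction ℝ}
    (hG₃ : ∀ d : ℕ, d ≠ 0 → G₃ d = if d.Coprime (v * q) then ∏ p ∈ d.primeFactors, 1 / ((p : ℝ) - 1) else 0)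
    {Gt : ArithmeticFunction ℝ}
    (hGt : ∀ d : ℕ, d ≠ 0 → Gt d = if d.Coprime (v * q * t) then
      ∏ p ∈ d.primeFactors, (if p < t.minFac then 1 / ((p : ℝ) - 1) else 1 / (p : ℝ)) else 0) :
    vprod Gt P ≤ Real.exp 3 * vprod G₃ P * ∏ p ∈ t.primeFactors, (1 + 3 / (p : ℝ)) := by
  classical
  have hP0 : P ≠ 0 := hP.ne_zero
  have htP : t ∣ P := Nat.dvd_of_mem_divisors ht
  have ht0 : t ≠ 0 := fun h0 => hP0 (Nat.eq_zero_of_zero_dvd (h0 ▸ htP))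
  -- every prime factor of `P` not dividing `vq` is `≥ 3`
  have hp3 : ∀ p ∈ P.primeFactors, ¬ p ∣ v * q → (3 : ℝ) ≤ p := by
    intro p hp hpvq
    have hp' := Nat.prime_of_mem_primeFactors hp
    have : 3 ≤ p := by
      by_contra hlt
      have hp2 : p = 2 := by have := hp'.two_le; omega
      exact hpvq (hp2 ▸ h2 (hp2 ▸ hp))
    exact_mod_cast this
  set c : ℕ → ℝ := fun p => (if p ∣ t then 1 + 3 / (p : ℝ) else 1) * (1 + 3 / (p : ℝ) ^ 2) with hc
  have hterm : ∀ p ∈ P.primeFactors, 0 ≤ 1 - Gt p ∧ 1 - Gt p ≤ (1 - G₃ p) * c p := by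
    intro p hp
    have hp' := Nat.prime_of_mem_primeFactors hp
    have hp0 : (0 : ℝ) < p := by exact_mod_cast hp'.pos
    rw [mulFn_prime hGt hp', mulFn_prime hG₃ hp']
    have hc1 : 1 ≤ c p := by
      simp only [hc]
      have h1 : (0 : ℝ) ≤ 3 / (p : ℝ) := by positivity
      have h2 : (0 : ℝ) ≤ 3 / (p : ℝ) ^ 2 := by positivity
      split_ifs <;> nlinarith
    by_cases hpvq : p ∣ v * q
    · have hpvqt : p ∣ v * q * t := hpvq.mul_right t
      rw [if_neg (not_not.mpr hpvqt), if_neg (not_not.mpr hpvq), sub_zero, one_mul]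
      exact ⟨zero_le_one, hc1⟩
    · have h3 := hp3 p hp hpvq
      rw [if_pos hpvq]
      have hden : (0 : ℝ) < (p : ℝ) - 1 := by linarith
      have hG₃v : 1 - 1 / ((p : ℝ) - 1) = ((p : ℝ) - 2) / ((p : ℝ) - 1) := by field_simp; ring
      by_cases hpt : p ∣ t
      · have hpvqt : p ∣ v * q * t := Dvd.dvd.mul_left hpt _
        rw [if_neg (not_not.mpr hpvqt), sub_zero, hG₃v]
        simp only [hc, if_pos hpt]
        refine ⟨zero_le_one, ?_⟩
        rw [div_mul_eq_mul_div, le_div_iff₀ hden]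
        have h4 : ((p : ℝ) - 2) * (1 + 3 / (p : ℝ)) ≥ (p : ℝ) - 1 := by
          rw [ge_iff_le, show ((p : ℝ) - 2) * (1 + 3 / (p : ℝ)) = ((p : ℝ) - 2) + 3 * ((p : ℝ) - 2) / p by ring,
            ← sub_nonneg]
          have : 3 * ((p : ℝ) - 2) / p - 1 = (2 * (p : ℝ) - 6) / p := by field_simp; ring
          nlinarith [div_nonneg (show (0:ℝ) ≤ 2 * p - 6 by linarith) hp0.le]
        have h5 : (0 : ℝ) ≤ 3 / (p : ℝ) ^ 2 := by positivity
        have h6 : 0 ≤ (p : ℝ) - 2 := by linarith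
        nlinarith [mul_nonneg h6 h5, mul_nonneg (show (0:ℝ) ≤ 1 + 3 / (p:ℝ) by positivity) h5]
      · have hpvqt : ¬ p ∣ v * q * t := by
          rw [hp'.dvd_mul]; push Not; exact ⟨hpvq, hpt⟩
        rw [if_pos hpvqt]
        simp only [hc, if_neg hpt, one_mul]
        by_cases hlt : p < t.minFac
        · rw [if_pos hlt, hG₃v]
          refine ⟨div_nonneg (by linarith) hden.le, ?_⟩
          have h5 : (0 : ℝ) ≤ 3 / (p : ℝ) ^ 2 := by positivity
          have h6 : 0 ≤ ((p : ℝ) - 2) / ((p : ℝ) - 1) := div_nonneg (by linarith) hden.le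
          nlinarith
        · rw [if_neg hlt, hG₃v]
          refine ⟨by rw [sub_nonneg, div_le_one hp0]; linarith, ?_⟩
          rw [div_mul_eq_mul_div, le_div_iff₀ hden, sub_mul, one_mul, div_mul_eq_mul_div,
            sub_le_iff_le_add]
          rw [show ((p : ℝ) - 2) * (1 + 3 / (p : ℝ) ^ 2) = (p : ℝ) - 2 + 3 * ((p : ℝ) - 2) / (p : ℝ) ^ 2 by ring]
          have h7 : 1 * ((p : ℝ) - 1) / p = 1 - 1 / p := by field_simp
          rw [h7]
          have h8 : 3 * ((p : ℝ) - 2) / (p : ℝ) ^ 2 ≥ 1 / p := by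
            rw [ge_iff_le, div_le_div_iff₀ hp0 (by positivity)]
            nlinarith
          linarith
  calc vprod Gt P = ∏ p ∈ P.primeFactors, (1 - Gt p) := rfl
    _ ≤ ∏ p ∈ P.primeFactors, (1 - G₃ p) * c p :=
        Finset.prod_le_prod (fun p hp => (hterm p hp).1) fun p hp => (hterm p hp).2
    _ = vprod G₃ P * ((∏ p ∈ P.primeFactors, (if p ∣ t then 1 + 3 / (p : ℝ) else 1)) *
          ∏ p ∈ P.primeFactors, (1 + 3 / (p : ℝ) ^ 2)) := by
        rw [Finset.prod_mul_distrib, vprod, Finset.prod_mul_distrib]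
    _ = vprod G₃ P * ((∏ p ∈ t.primeFactors, (1 + 3 / (p : ℝ))) *
          ∏ p ∈ P.primeFactors, (1 + 3 / (p : ℝ) ^ 2)) := by
        congr 2
        rw [← Finset.prod_filter]
        refine Finset.prod_congr ?_ fun _ _ => rfl
        ext p
        rw [Finset.mem_filter, Nat.mem_primeFactors, Nat.mem_primeFactors]
        constructor
        · rintro ⟨⟨hp, -, -⟩, hpt⟩; exact ⟨hp, hpt, ht0⟩
        · rintro ⟨hp, hpt, -⟩; exact ⟨⟨hp, hpt.trans htP, hP0⟩, hpt⟩
    _ ≤ vprod G₃ P * ((∏ p ∈ t.primeFactors, (1 + 3 / (p : ℝ))) * Real.exp 3) := by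
        have hV0 : 0 ≤ vprod G₃ P := by
          refine Finset.prod_nonneg fun p hp => ?_
          have hp' := Nat.prime_of_mem_primeFactors hp
          rw [mulFn_prime hG₃ hp']
          by_cases h : ¬ p ∣ v * q
          · have h3 := hp3 p hp h
            rw [if_pos h, sub_nonneg, div_le_one (by linarith)]; linarith
          · rw [if_neg h]; simp
        have hT0 : 0 ≤ ∏ p ∈ t.primeFactors, (1 + 3 / (p : ℝ)) :=
          Finset.prod_nonneg fun p _ => by positivity
        exact mul_le_mul_of_nonneg_left (mul_le_mul_of_nonneg_left (prod_one_add_three_div_sq_le P) hT0) hV0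
    _ = Real.exp 3 * vprod G₃ P * ∏ p ∈ t.primeFactors, (1 + 3 / (p : ℝ)) := by ring

/-- **`W(t) ≤ V_q ∏_{p ∣ P, p ≥ q(t)} (1 + 6/p)`** where `W(t) = ∏_{p ∣ P, p < q(t), p ∤ q}(1 − 1/p)`,
`V_q = ∏_{p ∣ P, p ∤ q}(1 − 1/p)` (an instance of `vlt_le_vprod_mul_prod` for the density
`1_{p ∤ q}/p`). [cite: MatomakiMerikoski2023, Lemma 3.3 (proof)] -/
theorem W_le {P : ℕ} (q : ℕ) (Q : ℕ) :
    ∏ p ∈ P.primeFactors.filter (fun p => p < Q ∧ ¬ p ∣ q), (1 - 1 / (p : ℝ)) ≤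
      (∏ p ∈ P.primeFactors.filter (fun p => ¬ p ∣ q), (1 - 1 / (p : ℝ))) *
        ∏ p ∈ P.primeFactors.filter (fun p => ¬ p < Q), (1 + 6 / (p : ℝ)) := by
  classical
  obtain ⟨Gq, -, hGq⟩ := exists_mulFn (fun p => 1 / (p : ℝ)) q
  have hg1 : ∀ p ∈ P.primeFactors, |Gq p| ≤ 2 / p := by
    intro p hp
    have hp' := Nat.prime_of_mem_primeFactors hp
    have hp0 : (0 : ℝ) < p := by exact_mod_cast hp'.pos
    rw [mulFn_prime hGq hp']
    by_cases h : ¬ p ∣ q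
    · rw [if_pos h, abs_of_nonneg (by positivity)]
      exact div_le_div_of_nonneg_right (by norm_num) hp0.le
    · rw [if_neg h, abs_zero]; positivity
  have hg2 : ∀ p ∈ P.primeFactors, Gq p ≤ 2 / 3 := by
    intro p hp
    have hp' := Nat.prime_of_mem_primeFactors hp
    have hp2 : (2 : ℝ) ≤ p := by exact_mod_cast hp'.two_le
    rw [mulFn_prime hGq hp']
    by_cases h : ¬ p ∣ q
    · rw [if_pos h, div_le_div_iff₀ (by linarith) (by norm_num)]; linarith
    · rw [if_neg h]; norm_num
  have h := vlt_le_vprod_mul_prod hg1 hg2 Q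
  have hW : vlt Gq P Q = ∏ p ∈ P.primeFactors.filter (fun p => p < Q ∧ ¬ p ∣ q), (1 - 1 / (p : ℝ)) := by
    rw [vlt, Finset.prod_filter, Finset.prod_filter]
    refine Finset.prod_congr rfl fun p hp => ?_
    rw [mulFn_prime hGq (Nat.prime_of_mem_primeFactors hp)]
    by_cases hlt : p < Q
    · rw [if_pos hlt]
      by_cases hpq : ¬ p ∣ q
      · rw [if_pos hpq, if_pos ⟨hlt, hpq⟩]
      · rw [if_neg hpq, if_neg (fun h' => hpq h'.2), sub_zero]
    · rw [if_neg hlt, if_neg (fun h' => hlt h'.1)]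
  have hV : vprod Gq P = ∏ p ∈ P.primeFactors.filter (fun p => ¬ p ∣ q), (1 - 1 / (p : ℝ)) := by
    rw [vprod, Finset.prod_filter]
    refine Finset.prod_congr rfl fun p hp => ?_
    rw [mulFn_prime hGq (Nat.prime_of_mem_primeFactors hp)]
    by_cases h : ¬ p ∣ q
    · rw [if_pos h, if_pos h]
    · rw [if_neg h, if_neg h, sub_zero]
  rw [← hW, ← hV]
  exact h

/-! ### Lemma 3.3: the geometric tail and the densities -/

/-- The geometric tail common to Lemma 3.2 (ii) and Lemma 3.3: with `b = β/(β−1)`, `K ∈ ℕ`,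
`A ≥ 1` and `β ≥ 2 + 6K/A` one has `b^K 2^{−A} ≤ e^{−A/2}` and hence
`∑_{r ≤ N, r > s − β} (b^K 2^{−A})^r ≤ 3 e^{Aβ/2} e^{−As/2}`.
[cite: MatomakiMerikoski2023, Lemma 3.2 (ii) (proof, last display)] -/
theorem sum_geometric_window_le {β : ℝ} (hβ : 1 < β) {A K : ℕ} (hA : 1 ≤ A)
    (hβA : 2 + 6 * (K : ℝ) / A ≤ β) (N : ℕ) (s : ℝ) :
    ∑ r ∈ (Finset.range (N + 1)).filter (fun r : ℕ => s - β < (r : ℝ)),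
        ((β / (β - 1)) ^ K / (2 : ℝ) ^ A) ^ r ≤
      3 * Real.exp ((A : ℝ) * β / 2) * Real.exp (-(A : ℝ) * s / 2) := by
  have hA0 : (0 : ℝ) < A := by exact_mod_cast hA
  set b : ℝ := β / (β - 1) with hb
  have hβ1 : 0 < β - 1 := by linarith
  have hb1 : 1 < b := by rw [hb, one_lt_div hβ1]; linarith
  have hb0 : 0 < b := by linarith
  set x : ℝ := b ^ K / 2 ^ A with hx
  have hx0 : 0 ≤ x := by positivity
  have hlogb : Real.log b ≤ 1 / (β - 1) := by
    have h := Real.log_le_sub_one_of_pos hb0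
    have : b - 1 = 1 / (β - 1) := by rw [hb]; field_simp; ring
    linarith
  have hKβ : (K : ℝ) / (β - 1) ≤ A / 6 := by
    rw [div_le_div_iff₀ hβ1 (by norm_num)]
    have h1 : 6 * (K : ℝ) / A ≤ β - 2 := by linarith
    rw [div_le_iff₀ hA0] at h1
    nlinarith
  have hbK : b ^ K ≤ Real.exp (A / 6) := by
    rw [← Real.exp_log (pow_pos hb0 K), Real.exp_le_exp, Real.log_pow]
    calc (K : ℝ) * Real.log b ≤ K * (1 / (β - 1)) :=
          mul_le_mul_of_nonneg_left hlogb (Nat.cast_nonneg K)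
      _ = K / (β - 1) := by ring
      _ ≤ A / 6 := hKβ
  have hxe : x ≤ Real.exp (-(A : ℝ) / 2) := by
    have h2A : (2 : ℝ) ^ A = Real.exp (A * Real.log 2) := by
      rw [← Real.rpow_natCast, Real.rpow_def_of_pos (by norm_num), mul_comm]
    rw [hx, div_le_iff₀ (by positivity), h2A, ← Real.exp_add]
    refine hbK.trans (Real.exp_le_exp.mpr ?_)
    nlinarith [Real.log_two_gt_d9]
  have hx1 : x ≤ 2 / 3 := by
    refine hxe.trans ((Real.exp_le_exp.mpr ?_).trans exp_neg_one_half_le_two_thirds)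
    have : (1 : ℝ) ≤ A := by exact_mod_cast hA
    linarith
  have hx1' : x < 1 := by linarith
  set r₀ : ℕ := ⌈s - β⌉₊ with hr₀
  have hsub : (Finset.range (N + 1)).filter (fun r : ℕ => s - β < (r : ℝ)) ⊆ Finset.Ico r₀ (N + 1) := by
    intro r hr
    rw [Finset.mem_filter, Finset.mem_range] at hr
    exact Finset.mem_Ico.mpr ⟨Nat.ceil_le.mpr hr.2.le, hr.1⟩
  have hxr₀ : x ^ r₀ ≤ Real.exp ((A : ℝ) * β / 2) * Real.exp (-(A : ℝ) * s / 2) := by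
    have h1 : x ^ r₀ ≤ Real.exp (-(A : ℝ) / 2) ^ r₀ := pow_le_pow_left₀ hx0 hxe r₀
    have h2 : Real.exp (-(A : ℝ) / 2) ^ r₀ = Real.exp (-(A : ℝ) / 2 * r₀) := by
      rw [← Real.exp_nat_mul]; ring_nf
    have hr₀s : s - β ≤ (r₀ : ℝ) := Nat.le_ceil _
    rw [h2] at h1
    refine h1.trans ?_
    rw [← Real.exp_add]
    apply Real.exp_le_exp.mpr
    nlinarith
  calc ∑ r ∈ (Finset.range (N + 1)).filter (fun r : ℕ => s - β < (r : ℝ)), x ^ r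
      ≤ ∑ r ∈ Finset.Ico r₀ (N + 1), x ^ r :=
        Finset.sum_le_sum_of_subset_of_nonneg hsub fun r _ _ => by positivity
    _ ≤ x ^ r₀ / (1 - x) := geom_sum_Ico_le_of_lt_one hx0 hx1'
    _ = x ^ r₀ * (1 / (1 - x)) := by ring
    _ ≤ (Real.exp ((A : ℝ) * β / 2) * Real.exp (-(A : ℝ) * s / 2)) * 3 := by
        refine mul_le_mul hxr₀ ?_ (by positivity) (by positivity)
        rw [div_le_iff₀ (by linarith)]; linarith
    _ = 3 * Real.exp ((A : ℝ) * β / 2) * Real.exp (-(A : ℝ) * s / 2) := by ring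

/-- The sieve hypotheses of Lemma 3.2 (ii) for the densities `g_t` of Lemma 3.3 (`|g_t(p)| ≤ 2/p`,
`g_t(p) ≤ 2/3` on the prime factors of `P`; uses `2 ∣ P → 2 ∣ vq`). [cite: MatomakiMerikoski2023, Lemma 3.3 (proof)] -/
theorem Gt_hyps {P : ℕ} {q v t : ℕ} (h2 : 2 ∈ P.primeFactors → 2 ∣ v * q)
    {Gt : ArithmeticFunction ℝ}
    (hGt : ∀ d : ℕ, d ≠ 0 → Gt d = if d.Coprime (v * q * t) then
      ∏ p ∈ d.primeFactors, (if p < t.minFac then 1 / ((p : ℝ) - 1) else 1 / (p : ℝ)) else 0) :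
    (∀ p ∈ P.primeFactors, |Gt p| ≤ 2 / p) ∧ (∀ p ∈ P.primeFactors, Gt p ≤ 2 / 3) := by
  have key : ∀ p ∈ P.primeFactors, 0 ≤ Gt p ∧ Gt p ≤ 2 / p ∧ Gt p ≤ 2 / 3 := by
    intro p hp
    have hp' := Nat.prime_of_mem_primeFactors hp
    have hp2 : (2 : ℝ) ≤ p := by exact_mod_cast hp'.two_le
    have hp0 : (0 : ℝ) < p := by linarith
    rw [mulFn_prime hGt hp']
    by_cases h : ¬ p ∣ v * q * t
    · rw [if_pos h]
      have hpvq : ¬ p ∣ v * q := fun h' => h (h'.mul_right t)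
      have h3 : (3 : ℝ) ≤ p := by
        have : 3 ≤ p := by
          by_contra hlt
          have hp2' : p = 2 := by have := hp'.two_le; omega
          exact hpvq (hp2' ▸ h2 (hp2' ▸ hp))
        exact_mod_cast this
      split_ifs
      · refine ⟨div_nonneg zero_le_one (by linarith), ?_, ?_⟩
        · rw [div_le_div_iff₀ (by linarith) hp0]; linarith
        · rw [div_le_div_iff₀ (by linarith) (by norm_num)]; linarith
      · refine ⟨by positivity, ?_, ?_⟩
        · exact div_le_div_of_nonneg_right (by norm_num) hp0.le
        · rw [div_le_div_iff₀ hp0 (by norm_num)]; linarith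
    · rw [if_neg h]
      exact ⟨le_rfl, by positivity, by norm_num⟩
  exact ⟨fun p hp => by rw [abs_of_nonneg (key p hp).1]; exact (key p hp).2.1,
    fun p hp => (key p hp).2.2⟩

/-- The same for the density `g₃ = 1_{(d,vq)=1}/φ(d)` of the main term. [cite: MatomakiMerikoski2023, Lemma 3.3 (proof)] -/
theorem G₃_hyps {P : ℕ} {q v : ℕ} (h2 : 2 ∈ P.primeFactors → 2 ∣ v * q)
    {G₃ : ArithmeticFunction ℝ}
    (hG₃ : ∀ d : ℕ, d ≠ 0 → G₃ d = if d.Coprime (v * q) then ∏ p ∈ d.primeFactors, 1 / ((p : ℝ) - 1) else 0) :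
    (∀ p ∈ P.primeFactors, |G₃ p| ≤ 2 / p) ∧ (∀ p ∈ P.primeFactors, G₃ p ≤ 2 / 3) := by
  have key : ∀ p ∈ P.primeFactors, 0 ≤ G₃ p ∧ G₃ p ≤ 2 / p ∧ G₃ p ≤ 2 / 3 := by
    intro p hp
    have hp' := Nat.prime_of_mem_primeFactors hp
    have hp2 : (2 : ℝ) ≤ p := by exact_mod_cast hp'.two_le
    have hp0 : (0 : ℝ) < p := by linarith
    rw [mulFn_prime hG₃ hp']
    by_cases h : ¬ p ∣ v * q
    · rw [if_pos h]
      have h3 : (3 : ℝ) ≤ p := by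
        have : 3 ≤ p := by
          by_contra hlt
          have hp2' : p = 2 := by have := hp'.two_le; omega
          exact h (hp2' ▸ h2 (hp2' ▸ hp))
        exact_mod_cast this
      refine ⟨div_nonneg zero_le_one (by linarith), ?_, ?_⟩
      · rw [div_le_div_iff₀ (by linarith) hp0]; linarith
      · rw [div_le_div_iff₀ (by linarith) (by norm_num)]; linarith
    · rw [if_neg h]
      exact ⟨le_rfl, by positivity, by norm_num⟩
  exact ⟨fun p hp => by rw [abs_of_nonneg (key p hp).1]; exact (key p hp).2.1,
    fun p hp => (key p hp).2.2⟩

/-! ### Lemma 3.3: the boundary terms -/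

/-- **One boundary term of Lemma 3.3**: for a boundary `t` of index `r` with `(t, q) = 1`,
`(1/t) W(t) |∑_{d₂ ∣ P} λ_{d₂} g_t(d₂)| ≤ (1 + C₀) e³ · V_q V₃ · ∏_{p ∣ P, p ≥ z_r}(1 + 6/p) · ∏_{p ∣ t}(1 + 3/p)/p`
(`C₀ = 3e^{24(6+2^{A+1})}e^{Aβ/2}` the constant of Lemma 3.2 (ii) applied to `g_t`; the source's
"Applying Lemma 3.2 (ii) and recombining the variables `m` and `p_r ≥ z_r`").
[cite: MatomakiMerikoski2023, Lemma 3.3 (proof)] -/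
theorem lemma33_bdry_term_le {P : ℕ} (hP : Squarefree P) {z β D : ℝ} (hβ : 1 < β) (hz : 1 < z)
    (hD1 : 1 < D) (hzD : β * Real.log z ≤ Real.log D) (hPz : ∀ p ∈ P.primeFactors, (p : ℝ) < z)
    {q v : ℕ} (h2 : 2 ∈ P.primeFactors → 2 ∣ v * q) {A : ℕ} (hA : 1 ≤ A)
    (hβA : 2 + 6 * ((6 : ℝ) + 2 ^ (A + 1)) / A ≤ β) {G₃ : ArithmeticFunction ℝ}
    (hG₃ : ∀ d : ℕ, d ≠ 0 → G₃ d = if d.Coprime (v * q) then ∏ p ∈ d.primeFactors, 1 / ((p : ℝ) - 1) else 0)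
    {r t : ℕ} (ht : t ∈ P.divisors.filter (fun t => bdry 1 β D t ≠ 0 ∧ t.primeFactors.card = r))
    {Gt : ArithmeticFunction ℝ} (hGtm : Gt.IsMultiplicative)
    (hGt : ∀ d : ℕ, d ≠ 0 → Gt d = if d.Coprime (v * q * t) then
      ∏ p ∈ d.primeFactors, (if p < t.minFac then 1 / ((p : ℝ) - 1) else 1 / (p : ℝ)) else 0) :
    1 / (t : ℝ) * (∏ p ∈ P.primeFactors.filter (fun p => p < t.minFac ∧ ¬ p ∣ q), (1 - 1 / (p : ℝ))) *
        |∑ d ∈ P.divisors, (μ d : ℝ) * ind 1 β D d * Gt d| ≤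
      (1 + 3 * Real.exp (24 * ((6 : ℝ) + 2 ^ (A + 1))) * Real.exp ((A : ℝ) * β / 2)) * Real.exp 3 *
        ((∏ p ∈ P.primeFactors.filter (fun p => ¬ p ∣ q), (1 - 1 / (p : ℝ))) * vprod G₃ P) *
        (∏ p ∈ P.primeFactors.filter (fun p : ℕ => z ^ ((1 - 1 / β) ^ r) ≤ (p : ℝ)), (1 + 6 / (p : ℝ))) *
        ∏ p ∈ t.primeFactors, (1 / (p : ℝ) * (1 + 3 / (p : ℝ))) := by
  classical
  obtain ⟨hsq, ht1, hzrq, -, -⟩ := bdry_fiber_props hP hβ hz hD1 hzD hPz ht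
  have htdiv : t ∈ P.divisors := (Finset.mem_filter.mp ht).1
  have hlogz : 0 < Real.log z := Real.log_pos hz
  have hs0 : 0 ≤ Real.log D / Real.log z := div_nonneg (Real.log_nonneg hD1.le) hlogz.le
  obtain ⟨hg1, hg2⟩ := Gt_hyps (P := P) h2 hGt
  obtain ⟨-, hg2₃⟩ := G₃_hyps (P := P) h2 hG₃
  have hU0 : 0 < vprod Gt P := vprod_pos_of_le hg2
  -- Lemma 3.2 (ii) for `g_t`
  have h32 := abs_upperSieveSum_sub_vprod_le hP hβ hz hD1 hzD hPz hGtm hg1 hg2 hA hβA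
  set C₀ : ℝ := 3 * Real.exp (24 * ((6 : ℝ) + 2 ^ (A + 1))) * Real.exp ((A : ℝ) * β / 2) with hC₀
  have hC₀0 : 0 ≤ C₀ := by positivity
  have hε1 : Real.exp (-(A : ℝ) * (Real.log D / Real.log z) / 2) ≤ 1 := by
    rw [Real.exp_le_one_iff]
    have : (0 : ℝ) ≤ A := Nat.cast_nonneg A
    nlinarith
  have hS : |∑ d ∈ P.divisors, (μ d : ℝ) * ind 1 β D d * Gt d| ≤ (1 + C₀) * vprod Gt P := by
    have h1 : |∑ d ∈ P.divisors, (μ d : ℝ) * ind 1 β D d * Gt d| ≤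
        |∑ d ∈ P.divisors, (μ d : ℝ) * ind 1 β D d * Gt d - vprod Gt P| + vprod Gt P := by
      have := abs_add_le (∑ d ∈ P.divisors, (μ d : ℝ) * ind 1 β D d * Gt d - vprod Gt P) (vprod Gt P)
      rwa [sub_add_cancel, abs_of_pos hU0] at this
    have h2' : C₀ * Real.exp (-(A : ℝ) * (Real.log D / Real.log z) / 2) * vprod Gt P ≤ C₀ * vprod Gt P := by
      calc C₀ * Real.exp (-(A : ℝ) * (Real.log D / Real.log z) / 2) * vprod Gt P
          ≤ C₀ * 1 * vprod Gt P := by gcongr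
        _ = C₀ * vprod Gt P := by ring
    have h3 : |∑ d ∈ P.divisors, (μ d : ℝ) * ind 1 β D d * Gt d - vprod Gt P| ≤ C₀ * vprod Gt P := by
      refine h32.trans (le_trans (le_of_eq ?_) h2')
      rw [hC₀]
    linarith
  -- the two product comparisons
  have hU := vprod_Gt_le hP htdiv h2 hG₃ hGt
  have hW := W_le (P := P) q t.minFac
  have hM₁ : ∏ p ∈ P.primeFactors.filter (fun p => ¬ p < t.minFac), (1 + 6 / (p : ℝ)) ≤
      ∏ p ∈ P.primeFactors.filter (fun p : ℕ => z ^ ((1 - 1 / β) ^ r) ≤ (p : ℝ)), (1 + 6 / (p : ℝ)) := by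
    refine Finset.prod_le_prod_of_subset_of_one_le ?_ (fun p _ => by positivity) (fun p _ _ => by
      have : (0 : ℝ) ≤ 6 / (p : ℝ) := by positivity
      linarith)
    intro p hp
    rw [Finset.mem_filter] at hp ⊢
    exact ⟨hp.1, hzrq.trans (by exact_mod_cast not_lt.mp hp.2)⟩
  have hH : ∏ p ∈ t.primeFactors, (1 / (p : ℝ) * (1 + 3 / (p : ℝ))) =
      1 / (t : ℝ) * ∏ p ∈ t.primeFactors, (1 + 3 / (p : ℝ)) := by
    rw [Finset.prod_mul_distrib, one_div_eq_prod_of_squarefree hsq]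
  -- non-negativity of the pieces
  have ht0' : (0 : ℝ) < t := by
    exact_mod_cast Nat.pos_of_ne_zero hsq.ne_zero
  have hW0 : 0 ≤ ∏ p ∈ P.primeFactors.filter (fun p => p < t.minFac ∧ ¬ p ∣ q), (1 - 1 / (p : ℝ)) :=
    Finset.prod_nonneg fun p hp => by
      have hp2 : (2 : ℝ) ≤ p := by
        exact_mod_cast (Nat.prime_of_mem_primeFactors (Finset.mem_filter.mp hp).1).two_le
      rw [sub_nonneg, div_le_one (by linarith)]; linarith
  have hVq0 : 0 ≤ ∏ p ∈ P.primeFactors.filter (fun p => ¬ p ∣ q), (1 - 1 / (p : ℝ)) :=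
    Finset.prod_nonneg fun p hp => by
      have hp2 : (2 : ℝ) ≤ p := by
        exact_mod_cast (Nat.prime_of_mem_primeFactors (Finset.mem_filter.mp hp).1).two_le
      rw [sub_nonneg, div_le_one (by linarith)]; linarith
  have hV₃0 : 0 < vprod G₃ P := vprod_pos_of_le hg2₃
  have hM₁0 : 0 ≤ ∏ p ∈ P.primeFactors.filter (fun p => ¬ p < t.minFac), (1 + 6 / (p : ℝ)) :=
    Finset.prod_nonneg fun p _ => by positivity
  have hT0 : 0 ≤ ∏ p ∈ t.primeFactors, (1 + 3 / (p : ℝ)) := Finset.prod_nonneg fun p _ => by positivity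
  -- combine
  set Wt := ∏ p ∈ P.primeFactors.filter (fun p => p < t.minFac ∧ ¬ p ∣ q), (1 - 1 / (p : ℝ)) with hWt
  set Vq := ∏ p ∈ P.primeFactors.filter (fun p => ¬ p ∣ q), (1 - 1 / (p : ℝ)) with hVq
  set M₁ := ∏ p ∈ P.primeFactors.filter (fun p => ¬ p < t.minFac), (1 + 6 / (p : ℝ)) with hM₁def
  set M₁' := ∏ p ∈ P.primeFactors.filter (fun p : ℕ => z ^ ((1 - 1 / β) ^ r) ≤ (p : ℝ)), (1 + 6 / (p : ℝ))
    with hM₁'def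
  set Tt := ∏ p ∈ t.primeFactors, (1 + 3 / (p : ℝ)) with hTt
  set S := |∑ d ∈ P.divisors, (μ d : ℝ) * ind 1 β D d * Gt d| with hSdef
  rw [hH]
  calc 1 / (t : ℝ) * Wt * S ≤ 1 / (t : ℝ) * (Vq * M₁) * ((1 + C₀) * vprod Gt P) := by
        refine mul_le_mul (mul_le_mul_of_nonneg_left hW (by positivity)) hS (abs_nonneg _) (by positivity)
    _ ≤ 1 / (t : ℝ) * (Vq * M₁') * ((1 + C₀) * (Real.exp 3 * vprod G₃ P * Tt)) := by
        refine mul_le_mul (mul_le_mul_of_nonneg_left (mul_le_mul_of_nonneg_left hM₁ hVq0) (by positivity))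
          (mul_le_mul_of_nonneg_left hU (by positivity)) (by positivity) (by positivity)
    _ = (1 + C₀) * Real.exp 3 * (Vq * vprod G₃ P) * M₁' * (1 / (t : ℝ) * Tt) := by ring

/-! ### Lemma 3.3: assembly -/

/-- **Matomäki–Merikoski 2023, Lemma 3.3, for a general sifting range** (the heart of the printed
proof): for squarefree `P` with prime factors `< z` (`1 < z`, `1 < β`, `1 < D`, `z^β ≤ D`,
`s = log D/log z`), `v, q ≥ 1` with `2 ∣ vq` whenever `2 ∣ P`, `A ≥ 1` and
`β ≥ 2 + 6(6 + 2^{A+2})/A`, the composite sum of the upper `β`-sieve weights `λ_d = μ(d)χ⁺(d)`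
satisfies
`|∑_{d₁, d₂ ∣ P, (d₂, d₁v) = 1, (d₁d₂, q) = 1} λ_{d₁}λ_{d₂}/(d₁d₂) − M| ≤ C(β, A) e^{−As/2} M`,
`M = ∏_{p ∣ P, p ∤ q}(1 − 1/p) ∏_{p ∣ P, p ∤ vq}(1 − 1/(p−1))`, with
`C = C₀ + 3(1 + C₀) e³ e^{24(6+2^{A+2})} e^{Aβ/2}`, `C₀ = 3 e^{24(6+2^{A+1})} e^{Aβ/2}`.
Proof as printed: the inner sum over `d₁` is expanded EXACTLY by the main-term identity with
`g(d) = 1_{(d,d₂q)=1}/d` ((eq:lamd/d)); its main part gives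
`∏_{p∤q}(1 − 1/p) ∑_{d₂} λ_{d₂} 1_{(d₂,vq)=1}/φ(d₂)`, evaluated by Lemma 3.2 (ii)
(`main_factor_eq`, `abs_upperSieveSum_sub_vprod_le`); its boundary part, summed over `d₂` first,
is `∑_t μ(t)χ̄(t) 1_{(t,q)=1} t⁻¹ W(t) ∑_{d₂} λ_{d₂} g_t(d₂)` (`bdry_factor_eq`), where Lemma 3.2 (ii)
for `g_t`, the comparisons `U_t ≤ e³ V₃ ∏_{p∣t}(1+3/p)`, `W(t) ≤ V_q ∏_{p ≥ z_r}(1+6/p)`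
(`lemma33_bdry_term_le`), the weighted count of boundary terms of index `r`
(`sum_bdry_fiber_weight_le`), Mertens in windows and the geometric tail finish the proof.
The hypothesis `2 ∣ P → 2 ∣ vq` is NOT printed: without it (`P = P(z)`, `z > 2`, `vq` odd) the
right-hand side vanishes (`1 − 1/φ(2) = 0`) while the left-hand side does not, so the printed
relative-error statement fails; in the source's application ((5.5), `v = h m₁` with `h` even) it
holds. [cite: MatomakiMerikoski2023, Lemma 3.3] -/
theorem abs_compositeSieveSum_sub_le {P : ℕ} (hP : Squarefree P) {z β D : ℝ} (hβ : 1 < β)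
    (hz : 1 < z) (hD1 : 1 < D) (hzD : β * Real.log z ≤ Real.log D)
    (hPz : ∀ p ∈ P.primeFactors, (p : ℝ) < z) {v q : ℕ}
    (h2 : 2 ∈ P.primeFactors → 2 ∣ v * q) {A : ℕ} (hA : 1 ≤ A)
    (hβA : 2 + 6 * ((6 : ℝ) + 2 ^ (A + 2)) / A ≤ β) :
    |(∑ d₁ ∈ P.divisors, ∑ d₂ ∈ P.divisors,
        if d₂.Coprime (d₁ * v) ∧ (d₁ * d₂).Coprime q then
          (μ d₁ : ℝ) * ind 1 β D d₁ * ((μ d₂ : ℝ) * ind 1 β D d₂) / ((d₁ : ℝ) * d₂) else 0) -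
        (∏ p ∈ P.primeFactors.filter (fun p => ¬ p ∣ q), (1 - 1 / (p : ℝ))) *
          ∏ p ∈ P.primeFactors.filter (fun p => ¬ p ∣ v * q), (1 - 1 / ((p : ℝ) - 1))| ≤
      (3 * Real.exp (24 * ((6 : ℝ) + 2 ^ (A + 1))) * Real.exp ((A : ℝ) * β / 2) +
        3 * (1 + 3 * Real.exp (24 * ((6 : ℝ) + 2 ^ (A + 1))) * Real.exp ((A : ℝ) * β / 2)) *
          Real.exp 3 * Real.exp (24 * ((6 : ℝ) + 2 ^ (A + 2))) * Real.exp ((A : ℝ) * β / 2)) *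
        Real.exp (-(A : ℝ) * (Real.log D / Real.log z) / 2) *
        ((∏ p ∈ P.primeFactors.filter (fun p => ¬ p ∣ q), (1 - 1 / (p : ℝ))) *
          ∏ p ∈ P.primeFactors.filter (fun p => ¬ p ∣ v * q), (1 - 1 / ((p : ℝ) - 1))) := by
  classical
  have hP0 : P ≠ 0 := hP.ne_zero
  have hA0 : (0 : ℝ) < A := by exact_mod_cast hA
  have hlogz : 0 < Real.log z := Real.log_pos hz
  -- `β` is also large enough for the constant `6 + 2^{A+1}`
  have hβA' : 2 + 6 * ((6 : ℝ) + 2 ^ (A + 1)) / A ≤ β := by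
    refine le_trans ?_ hβA
    have : (2 : ℝ) ^ (A + 1) ≤ 2 ^ (A + 2) := pow_le_pow_right₀ (by norm_num) (by omega)
    gcongr
  have hβAK : 2 + 6 * (((6 + 2 ^ (A + 2) : ℕ) : ℕ) : ℝ) / A ≤ β := by push_cast; exact hβA
  -- the densities
  have hG₂ex : ∀ d₂ : ℕ, ∃ F : ArithmeticFunction ℝ, F.IsMultiplicative ∧
      ∀ d : ℕ, d ≠ 0 → F d = if d.Coprime (d₂ * q) then ∏ p ∈ d.primeFactors, 1 / (p : ℝ) else 0 :=
    fun d₂ => exists_mulFn _ _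
  choose G₂ hG₂m hG₂ using hG₂ex
  obtain ⟨G₃, hG₃m, hG₃⟩ := exists_mulFn (fun p => 1 / ((p : ℝ) - 1)) (v * q)
  have hGtex : ∀ t : ℕ, ∃ F : ArithmeticFunction ℝ, F.IsMultiplicative ∧
      ∀ d : ℕ, d ≠ 0 → F d = if d.Coprime (v * q * t) then
        ∏ p ∈ d.primeFactors, (if p < t.minFac then 1 / ((p : ℝ) - 1) else 1 / (p : ℝ)) else 0 :=
    fun t => exists_mulFn _ _
  choose Gt hGtm hGt using hGtex
  obtain ⟨H, hHm, hH⟩ := exists_mulFn (fun p => 1 / (p : ℝ) * (1 + 3 / (p : ℝ))) 1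
  obtain ⟨hg1₃, hg2₃⟩ := G₃_hyps (P := P) h2 hG₃
  -- abbreviations
  set lam : ℕ → ℝ := fun d => (μ d : ℝ) * ind 1 β D d with hlam
  set Vq : ℝ := ∏ p ∈ P.primeFactors.filter (fun p => ¬ p ∣ q), (1 - 1 / (p : ℝ)) with hVq
  have hV₃ : vprod G₃ P = ∏ p ∈ P.primeFactors.filter (fun p => ¬ p ∣ v * q), (1 - 1 / ((p : ℝ) - 1)) := by
    rw [vprod, Finset.prod_filter]
    refine Finset.prod_congr rfl fun p hp => ?_
    rw [mulFn_prime hG₃ (Nat.prime_of_mem_primeFactors hp)]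
    by_cases h : ¬ p ∣ v * q
    · rw [if_pos h, if_pos h]
    · rw [if_neg h, if_neg h, sub_zero]
  set V₃ : ℝ := vprod G₃ P with hV₃def
  rw [← hV₃]
  have hVq0 : 0 ≤ Vq := Finset.prod_nonneg fun p hp => by
    have hp2 : (2 : ℝ) ≤ p := by
      exact_mod_cast (Nat.prime_of_mem_primeFactors (Finset.mem_filter.mp hp).1).two_le
    rw [sub_nonneg, div_le_one (by linarith)]; linarith
  have hV₃0 : 0 < V₃ := vprod_pos_of_le hg2₃
  set F₂ := P.divisors.filter (fun d₂ => d₂.Coprime (v * q)) with hF₂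
  set S₁ : ℕ → ℝ := fun d₂ => ∑ d₁ ∈ P.divisors, (μ d₁ : ℝ) * ind 1 β D d₁ * G₂ d₂ d₁ with hS₁
  set B : ℕ → ℝ := fun d₂ => ∑ t ∈ P.divisors, (μ t : ℝ) * bdry 1 β D t * G₂ d₂ t * vlt (G₂ d₂) P t.minFac
    with hB
  -- Step 0: reindex the double sum
  have hstep0 : (∑ d₁ ∈ P.divisors, ∑ d₂ ∈ P.divisors,
      if d₂.Coprime (d₁ * v) ∧ (d₁ * d₂).Coprime q then
        (μ d₁ : ℝ) * ind 1 β D d₁ * ((μ d₂ : ℝ) * ind 1 β D d₂) / ((d₁ : ℝ) * d₂) else 0) =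
      ∑ d₂ ∈ F₂, lam d₂ / (d₂ : ℝ) * S₁ d₂ := by
    rw [Finset.sum_comm, hF₂, Finset.sum_filter]
    refine Finset.sum_congr rfl fun d₂ hd₂ => ?_
    have hd₂P : d₂ ∣ P := Nat.dvd_of_mem_divisors hd₂
    have hd₂0 : d₂ ≠ 0 := fun h0 => hP0 (Nat.eq_zero_of_zero_dvd (h0 ▸ hd₂P))
    by_cases hcop : d₂.Coprime (v * q)
    · rw [if_pos hcop, hS₁, Finset.mul_sum]
      refine Finset.sum_congr rfl fun d₁ hd₁ => ?_
      have hd₁P : d₁ ∣ P := Nat.dvd_of_mem_divisors hd₁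
      have hd₁0 : d₁ ≠ 0 := fun h0 => hP0 (Nat.eq_zero_of_zero_dvd (h0 ▸ hd₁P))
      have hsq₁ : Squarefree d₁ := hP.squarefree_of_dvd hd₁P
      have hcv : d₂.Coprime v := Nat.Coprime.coprime_mul_right_right hcop
      have hcq : d₂.Coprime q := Nat.Coprime.coprime_mul_left_right hcop
      have hiff : (d₂.Coprime (d₁ * v) ∧ (d₁ * d₂).Coprime q) ↔ d₁.Coprime (d₂ * q) := by
        rw [Nat.coprime_mul_iff_right, Nat.coprime_mul_iff_left, Nat.coprime_mul_iff_right]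
        constructor
        · rintro ⟨⟨h1, -⟩, h3, -⟩; exact ⟨h1.symm, h3⟩
        · rintro ⟨h1, h3⟩; exact ⟨⟨h1.symm, hcv⟩, h3, hcq⟩
      have hG₂d₁ : G₂ d₂ d₁ = if d₁.Coprime (d₂ * q) then 1 / (d₁ : ℝ) else 0 := by
        rw [hG₂ d₂ d₁ hd₁0, one_div_eq_prod_of_squarefree hsq₁]
      rw [hG₂d₁]
      by_cases hc : d₁.Coprime (d₂ * q)
      · rw [if_pos (hiff.mpr hc), if_pos hc, hlam]
        field_simp
      · rw [if_neg (fun h => hc (hiff.mp h)), if_neg hc]; ring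
    · rw [if_neg hcop]
      refine Finset.sum_eq_zero fun d₁ _ => ?_
      rw [if_neg]
      rintro ⟨h1, h3⟩
      apply hcop
      rw [Nat.coprime_mul_iff_right] at h1 ⊢
      rw [Nat.coprime_mul_iff_left] at h3
      exact ⟨h1.2, h3.2⟩
  -- Step 1: the exact identity for the inner sum
  have hstep1 : ∀ d₂ : ℕ, S₁ d₂ = vprod (G₂ d₂) P - B d₂ := fun d₂ =>
    mainTerm_identity (par := 1) (β := β) (D := D) (hG₂m d₂) hP
  -- Step 2: the main part
  have hstep2 : ∑ d₂ ∈ F₂, lam d₂ / (d₂ : ℝ) * vprod (G₂ d₂) P =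
      Vq * ∑ d₂ ∈ P.divisors, (μ d₂ : ℝ) * ind 1 β D d₂ * G₃ d₂ := by
    rw [Finset.mul_sum, hF₂, Finset.sum_filter]
    refine Finset.sum_congr rfl fun d₂ hd₂ => ?_
    have hd₂P : d₂ ∣ P := Nat.dvd_of_mem_divisors hd₂
    have hd₂0 : d₂ ≠ 0 := fun h0 => hP0 (Nat.eq_zero_of_zero_dvd (h0 ▸ hd₂P))
    by_cases hcop : d₂.Coprime (v * q)
    · rw [if_pos hcop]
      have h := main_factor_eq hP hd₂ hcop (hG₂ d₂) hG₃
      calc lam d₂ / (d₂ : ℝ) * vprod (G₂ d₂) P = lam d₂ * (1 / (d₂ : ℝ) * vprod (G₂ d₂) P) := by ring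
        _ = lam d₂ * (Vq * G₃ d₂) := by rw [h]
        _ = Vq * ((μ d₂ : ℝ) * ind 1 β D d₂ * G₃ d₂) := by rw [hlam]; ring
    · rw [if_neg hcop, hG₃ d₂ hd₂0, if_neg hcop]; ring
  have h32main := abs_upperSieveSum_sub_vprod_le hP hβ hz hD1 hzD hPz hG₃m hg1₃ hg2₃ hA hβA'
  -- Step 3: the boundary part, summed over `d₂` first
  set Φ : ℕ → ℝ := fun t => if t.Coprime q then 1 / (t : ℝ) *
      ∏ p ∈ P.primeFactors.filter (fun p => p < t.minFac ∧ ¬ p ∣ q), (1 - 1 / (p : ℝ)) else 0 with hΦ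
  have hΦ0 : ∀ t, 0 ≤ Φ t := by
    intro t
    simp only [hΦ]
    split_ifs
    · refine mul_nonneg (by positivity) (Finset.prod_nonneg fun p hp => ?_)
      have hp2 : (2 : ℝ) ≤ p := by
        exact_mod_cast (Nat.prime_of_mem_primeFactors (Finset.mem_filter.mp hp).1).two_le
      rw [sub_nonneg, div_le_one (by linarith)]; linarith
    · exact le_rfl
  set St : ℕ → ℝ := fun t => ∑ d₂ ∈ P.divisors, (μ d₂ : ℝ) * ind 1 β D d₂ * Gt t d₂ with hSt
  have hstep3 : ∑ d₂ ∈ F₂, lam d₂ / (d₂ : ℝ) * B d₂ =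
      ∑ t ∈ P.divisors, (μ t : ℝ) * bdry 1 β D t * (Φ t * St t) := by
    have hinner : ∀ d₂ ∈ F₂, lam d₂ / (d₂ : ℝ) * B d₂ =
        ∑ t ∈ P.divisors, (μ t : ℝ) * bdry 1 β D t * (Φ t * (lam d₂ * Gt t d₂)) := by
      intro d₂ hd₂
      rw [hF₂, Finset.mem_filter] at hd₂
      rw [hB, Finset.mul_sum]
      refine Finset.sum_congr rfl fun t ht => ?_
      have h := bdry_factor_eq hP hd₂.1 hd₂.2 ht (hG₂ d₂) (hGt t) (lam d₂)
      calc lam d₂ / (d₂ : ℝ) * ((μ t : ℝ) * bdry 1 β D t * G₂ d₂ t * vlt (G₂ d₂) P t.minFac)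
          = (μ t : ℝ) * bdry 1 β D t * (lam d₂ / (d₂ : ℝ) * G₂ d₂ t * vlt (G₂ d₂) P t.minFac) := by ring
        _ = (μ t : ℝ) * bdry 1 β D t * (Φ t * (lam d₂ * Gt t d₂)) := by rw [h]
    rw [Finset.sum_congr rfl hinner, Finset.sum_comm]
    refine Finset.sum_congr rfl fun t ht => ?_
    rw [← Finset.mul_sum, ← Finset.mul_sum]
    congr 2
    -- drop the filter: off `F₂` the density `g_t` vanishes
    rw [hSt, hF₂, Finset.sum_filter]
    refine Finset.sum_congr rfl fun d₂ hd₂ => ?_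
    have hd₂P : d₂ ∣ P := Nat.dvd_of_mem_divisors hd₂
    have hd₂0 : d₂ ≠ 0 := fun h0 => hP0 (Nat.eq_zero_of_zero_dvd (h0 ▸ hd₂P))
    by_cases hcop : d₂.Coprime (v * q)
    · rw [if_pos hcop, hlam]
    · rw [if_neg hcop, hGt t d₂ hd₂0, if_neg (fun h => hcop (Nat.Coprime.coprime_mul_right_right h))]
      ring
  -- Step 4: the bound for the boundary part, fiberwise
  set Cb : ℝ := (1 + 3 * Real.exp (24 * ((6 : ℝ) + 2 ^ (A + 1))) * Real.exp ((A : ℝ) * β / 2)) * Real.exp 3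
    with hCb
  have hCb0 : 0 ≤ Cb := by positivity
  have hCVV : 0 ≤ Cb * (Vq * V₃) := mul_nonneg hCb0 (mul_nonneg hVq0 hV₃0.le)
  set b : ℝ := β / (β - 1) with hb
  have hβ1 : 0 < β - 1 := by linarith
  have hb0 : 0 < b := by rw [hb]; positivity
  set k' : ℕ := 2 ^ (A + 2) with hk'
  set K' : ℕ := 6 + k' with hK'
  have hK'r : (K' : ℝ) = 6 + 2 ^ (A + 2) := by rw [hK', hk']; push_cast; ring
  set x : ℝ := b ^ K' / 2 ^ A with hx
  -- properties of `H`
  have hH0 : ∀ d, 0 ≤ H d := by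
    intro d
    rcases Nat.eq_zero_or_pos d with rfl | hd
    · simp
    · rw [hH d hd.ne']
      split_ifs
      · exact Finset.prod_nonneg fun p _ => by positivity
      · exact le_rfl
  have hHp : ∀ p ∈ P.primeFactors, (2 : ℝ) ^ A * H p ≤ (k' : ℝ) / p := by
    intro p hp
    have hp' := Nat.prime_of_mem_primeFactors hp
    have hp2 : (2 : ℝ) ≤ p := by exact_mod_cast hp'.two_le
    have hp0 : (0 : ℝ) < p := by linarith
    rw [mulFn_prime hH hp', if_pos (Nat.Prime.not_dvd_one hp'), hk']
    push_cast
    have h1 : 1 + 3 / (p : ℝ) ≤ 4 := by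
      have : 3 / (p : ℝ) ≤ 3 / 2 := div_le_div_of_nonneg_left (by norm_num) (by norm_num) hp2
      linarith
    calc (2 : ℝ) ^ A * (1 / (p : ℝ) * (1 + 3 / (p : ℝ))) = (2 : ℝ) ^ A * (1 + 3 / (p : ℝ)) / p := by ring
      _ ≤ (2 : ℝ) ^ A * 4 / p := by gcongr
      _ = 2 ^ (A + 2) / p := by rw [pow_add]; norm_num
  have hHt : ∀ {r t : ℕ}, t ∈ P.divisors.filter (fun t => bdry 1 β D t ≠ 0 ∧ t.primeFactors.card = r) →
      ∏ p ∈ t.primeFactors, (1 / (p : ℝ) * (1 + 3 / (p : ℝ))) = H t := by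
    intro r t ht
    obtain ⟨hsq, -, -, -, -⟩ := bdry_fiber_props hP hβ hz hD1 hzD hPz ht
    rw [hH t hsq.ne_zero, if_pos (Nat.coprime_one_right t)]
  have hfiber : ∀ r : ℕ,
      ∑ t ∈ P.divisors.filter (fun t => bdry 1 β D t ≠ 0 ∧ t.primeFactors.card = r), Φ t * |St t| ≤
        if Real.log D < ((r : ℝ) + β) * Real.log z then Cb * (Vq * V₃) * Real.exp (24 * K') * x ^ r else 0 := by
    intro r
    by_cases hcond : Real.log D < ((r : ℝ) + β) * Real.log z
    · rw [if_pos hcond]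
      obtain ⟨hzr1, hzrz, hratio⟩ := zr_props hz hβ r
      set M₁' := ∏ p ∈ P.primeFactors.filter (fun p : ℕ => z ^ ((1 - 1 / β) ^ r) ≤ (p : ℝ)), (1 + 6 / (p : ℝ))
        with hM₁'def
      have hM₁'0 : 0 ≤ M₁' := Finset.prod_nonneg fun p _ => by positivity
      -- termwise
      have hterm : ∀ t ∈ P.divisors.filter (fun t => bdry 1 β D t ≠ 0 ∧ t.primeFactors.card = r),
          Φ t * |St t| ≤ Cb * (Vq * V₃) * M₁' * H t := by
        intro t ht
        rw [← hHt ht]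
        simp only [hΦ]
        split_ifs with htq
        · exact lemma33_bdry_term_le hP hβ hz hD1 hzD hPz h2 hA hβA' hG₃ ht (hGtm t) (hGt t)
        · rw [zero_mul]
          have := hH0 t
          rw [← hHt ht] at this
          positivity
      have hsumH := sum_bdry_fiber_weight_le hP hβ hz hD1 hzD hPz hHm hH0 A r
      have hM₁ := prod_one_add_div_le_pow hPz hzr1 hzrz 6
      have hM₂ := prod_one_add_div_le_pow hPz hzr1 hzrz k'
      rw [hratio] at hM₁ hM₂
      have h6 : (Nat.cast 6 : ℝ) = 6 := by norm_num
      rw [h6] at hM₁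
      have hM₂' : ∏ p ∈ P.primeFactors.filter (fun p : ℕ => z ^ ((1 - 1 / β) ^ r) ≤ (p : ℝ)),
          (1 + (2 : ℝ) ^ A * H p) ≤ (Real.exp 24 * (β / (β - 1)) ^ r) ^ k' := by
        refine le_trans (Finset.prod_le_prod (fun p _ => by linarith [mul_nonneg (by positivity : (0:ℝ) ≤ 2 ^ A) (hH0 p)]) fun p hp => ?_) hM₂
        linarith [hHp p (Finset.mem_filter.mp hp).1]
      have hpow2 : (0 : ℝ) < 2 ^ (A * r) := by positivity
      calc ∑ t ∈ P.divisors.filter (fun t => bdry 1 β D t ≠ 0 ∧ t.primeFactors.card = r), Φ t * |St t|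
          ≤ ∑ t ∈ P.divisors.filter (fun t => bdry 1 β D t ≠ 0 ∧ t.primeFactors.card = r),
              Cb * (Vq * V₃) * M₁' * H t := Finset.sum_le_sum hterm
        _ = Cb * (Vq * V₃) * M₁' *
              ∑ t ∈ P.divisors.filter (fun t => bdry 1 β D t ≠ 0 ∧ t.primeFactors.card = r), H t := by
            rw [Finset.mul_sum]
        _ ≤ Cb * (Vq * V₃) * (Real.exp 24 * (β / (β - 1)) ^ r) ^ 6 *
              ((Real.exp 24 * (β / (β - 1)) ^ r) ^ k' / (2 : ℝ) ^ (A * r)) := by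
            refine mul_le_mul (mul_le_mul_of_nonneg_left hM₁ hCVV) (hsumH.trans ?_)
              (Finset.sum_nonneg fun t _ => hH0 t) (mul_nonneg hCVV (by positivity))
            exact div_le_div_of_nonneg_right hM₂' hpow2.le
        _ = Cb * (Vq * V₃) * Real.exp (24 * K') * x ^ r := by
            have hE : Real.exp (24 * (K' : ℝ)) = Real.exp 24 ^ K' := by
              rw [← Real.exp_nat_mul, mul_comm]
            rw [hE, hx, hK', hb]
            ring
    · rw [if_neg hcond]
      have hempty : P.divisors.filter (fun t => bdry 1 β D t ≠ 0 ∧ t.primeFactors.card = r) = ∅ := by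
        refine Finset.filter_eq_empty_iff.mpr fun t ht hc => hcond ?_
        exact (bdry_fiber_props hP hβ hz hD1 hzD hPz (Finset.mem_filter.mpr ⟨ht, hc⟩)).2.2.2.2
      rw [hempty, Finset.sum_empty]
  -- Step 5: sum over the indices
  set N : ℕ := P.primeFactors.card with hN
  have hbdry : |∑ t ∈ P.divisors, (μ t : ℝ) * bdry 1 β D t * (Φ t * St t)| ≤
      Cb * (Vq * V₃) * Real.exp (24 * K') * (3 * Real.exp ((A : ℝ) * β / 2) *
        Real.exp (-(A : ℝ) * (Real.log D / Real.log z) / 2)) := by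
    set F₀ := P.divisors.filter (fun t => bdry 1 β D t ≠ 0) with hF₀
    have h1 : |∑ t ∈ P.divisors, (μ t : ℝ) * bdry 1 β D t * (Φ t * St t)| ≤
        ∑ t ∈ F₀, Φ t * |St t| := by
      refine (Finset.abs_sum_le_sum_abs _ _).trans ?_
      rw [hF₀, Finset.sum_filter]
      refine Finset.sum_le_sum fun t _ => ?_
      by_cases hbt : bdry 1 β D t = 0
      · rw [hbt, if_neg (fun h => h rfl)]; simp
      · rw [if_pos hbt, bdry_eq_one_of_ne_zero hbt, abs_mul, abs_mul, abs_mul, abs_of_nonneg (hΦ0 t)]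
        have hμ : |(μ t : ℝ)| ≤ 1 := by exact_mod_cast ArithmeticFunction.abs_moebius_le_one
        have h0 : 0 ≤ Φ t * |St t| := mul_nonneg (hΦ0 t) (abs_nonneg _)
        calc |(μ t : ℝ)| * |(1 : ℝ)| * (Φ t * |St t|) ≤ 1 * |(1 : ℝ)| * (Φ t * |St t|) := by gcongr
          _ = Φ t * |St t| := by simp
    have hmaps : ∀ t ∈ F₀, t.primeFactors.card ∈ Finset.range (N + 1) := by
      intro t ht
      have htP := Nat.dvd_of_mem_divisors (Finset.mem_filter.mp ht).1
      rw [Finset.mem_range, Nat.lt_succ_iff]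
      exact Finset.card_le_card (Nat.primeFactors_mono htP hP0)
    have hfib : ∑ t ∈ F₀, Φ t * |St t| =
        ∑ r ∈ Finset.range (N + 1), ∑ t ∈ F₀.filter (fun t => t.primeFactors.card = r), Φ t * |St t| :=
      (Finset.sum_fiberwise_of_maps_to hmaps _).symm
    have h2 : ∑ r ∈ Finset.range (N + 1), ∑ t ∈ F₀.filter (fun t => t.primeFactors.card = r), Φ t * |St t| ≤
        ∑ r ∈ Finset.range (N + 1), (if Real.log D < ((r : ℝ) + β) * Real.log z then
          Cb * (Vq * V₃) * Real.exp (24 * K') * x ^ r else 0) := by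
      refine Finset.sum_le_sum fun r _ => ?_
      rw [hF₀, Finset.filter_filter]
      exact hfiber r
    have h3 : ∑ r ∈ Finset.range (N + 1), (if Real.log D < ((r : ℝ) + β) * Real.log z then
          Cb * (Vq * V₃) * Real.exp (24 * K') * x ^ r else 0) =
        Cb * (Vq * V₃) * Real.exp (24 * K') *
          ∑ r ∈ (Finset.range (N + 1)).filter (fun r : ℕ => Real.log D / Real.log z - β < (r : ℝ)), x ^ r := by
      rw [Finset.mul_sum, ← Finset.sum_filter]
      refine Finset.sum_congr ?_ fun _ _ => rfl
      ext r
      simp only [Finset.mem_filter, Finset.mem_range, and_congr_right_iff]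
      intro _
      rw [sub_lt_iff_lt_add, div_lt_iff₀ hlogz]
    have h4 := sum_geometric_window_le hβ hA hβAK N (Real.log D / Real.log z)
    calc |∑ t ∈ P.divisors, (μ t : ℝ) * bdry 1 β D t * (Φ t * St t)| ≤ ∑ t ∈ F₀, Φ t * |St t| := h1
      _ = _ := hfib
      _ ≤ _ := h2
      _ = _ := h3
      _ ≤ Cb * (Vq * V₃) * Real.exp (24 * K') * (3 * Real.exp ((A : ℝ) * β / 2) *
            Real.exp (-(A : ℝ) * (Real.log D / Real.log z) / 2)) :=
          mul_le_mul_of_nonneg_left h4 (mul_nonneg hCVV (Real.exp_pos _).le)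
  -- Step 6: conclusion
  have hLHS : (∑ d₁ ∈ P.divisors, ∑ d₂ ∈ P.divisors,
      if d₂.Coprime (d₁ * v) ∧ (d₁ * d₂).Coprime q then
        (μ d₁ : ℝ) * ind 1 β D d₁ * ((μ d₂ : ℝ) * ind 1 β D d₂) / ((d₁ : ℝ) * d₂) else 0) =
      Vq * ∑ d₂ ∈ P.divisors, (μ d₂ : ℝ) * ind 1 β D d₂ * G₃ d₂ -
        ∑ t ∈ P.divisors, (μ t : ℝ) * bdry 1 β D t * (Φ t * St t) := by
    rw [hstep0, ← hstep2, ← hstep3, ← Finset.sum_sub_distrib]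
    refine Finset.sum_congr rfl fun d₂ _ => ?_
    rw [hstep1 d₂]; ring
  rw [hLHS]
  set Smain := ∑ d₂ ∈ P.divisors, (μ d₂ : ℝ) * ind 1 β D d₂ * G₃ d₂ with hSmain
  set Sb := ∑ t ∈ P.divisors, (μ t : ℝ) * bdry 1 β D t * (Φ t * St t) with hSb
  set ε : ℝ := Real.exp (-(A : ℝ) * (Real.log D / Real.log z) / 2) with hε
  set C₀ : ℝ := 3 * Real.exp (24 * ((6 : ℝ) + 2 ^ (A + 1))) * Real.exp ((A : ℝ) * β / 2) with hC₀
  have hmainb : |Vq * Smain - Vq * V₃| ≤ Vq * (C₀ * ε * V₃) := by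
    rw [← mul_sub, abs_mul, abs_of_nonneg hVq0]
    exact mul_le_mul_of_nonneg_left h32main hVq0
  have hK'exp : Real.exp (24 * (K' : ℝ)) = Real.exp (24 * ((6 : ℝ) + 2 ^ (A + 2))) := by rw [hK'r]
  rw [hK'exp] at hbdry
  calc |Vq * Smain - Sb - Vq * V₃| = |(Vq * Smain - Vq * V₃) + (-Sb)| := by ring_nf
    _ ≤ |Vq * Smain - Vq * V₃| + |-Sb| := abs_add_le _ _
    _ ≤ Vq * (C₀ * ε * V₃) + Cb * (Vq * V₃) * Real.exp (24 * ((6 : ℝ) + 2 ^ (A + 2))) *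
          (3 * Real.exp ((A : ℝ) * β / 2) * ε) := by
        rw [abs_neg]; exact add_le_add hmainb hbdry
    _ = (C₀ + 3 * Cb * Real.exp (24 * ((6 : ℝ) + 2 ^ (A + 2))) * Real.exp ((A : ℝ) * β / 2)) * ε *
          (Vq * V₃) := by ring
    _ = _ := by rw [hC₀, hCb]; ring

end Literature.Barriers.Parity.MatomakiMerikoski

/-! ### Lemma 3.3 in the parametrisation of the source -/

namespace Literature.Barriers.Parity

open Literature.NumberTheory.Sieve Literature.NumberTheory.Sieve.BetaSieve MatomakiMerikoski

/-- **Matomäki–Merikoski 2023, Lemma 3.3** (as printed, in the parametrisation of the source): "Let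
the assumptions and `λ_d` be as in Lemma 3.2 and let `v, q ∈ ℕ`. Then
`∑_{d₁, d₂ ∣ P(z), (d₂, d₁v) = 1, (d₁d₂, q) = 1} λ_{d₁}λ_{d₂}/(d₁d₂) = (1 + O_{β,A}(e^{−Auθ/2})) ∏_{p<z, p∤q}(1 − 1/p) ∏_{p<z, p∤vq}(1 − 1/φ(p))`."
Here `λ_d = μ(d) · BetaSieve.ind 1 β D d` (upper `β`-sieve weights, `D = X^θ`, `z = X^{1/u}`,
`P(z) = primesProdBelow z`), `1 − 1/φ(p) = 1 − 1/(p − 1)`, the `O_{β,A}` is an explicit `C(β, A)`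
(that of `MatomakiMerikoski.abs_compositeSieveSum_sub_le`) with `β₀(A) = 2 + 6(6 + 2^{A+2})/A`, for
every `A ≥ 1`, `θ, u > 0` with `uθ ≥ β`, `X > 1`; and with ONE EXTRA HYPOTHESIS, `2 ∣ vq`, not
printed in the source: for odd `vq` (and `z > 2`) the right-hand side vanishes because of the
factor `1 − 1/φ(2) = 0` while the left-hand side does not, so the statement as printed fails; in
the source's application ((5.5): `v = h m₁`, `h` even — "Theorems 1.3 and 1.4 are trivial unless
`h` is even") the hypothesis holds. [cite: MatomakiMerikoski2023, Lemma 3.3] -/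
theorem MatomakiMerikoski2023_lemma33 (A : ℕ) (hA : 1 ≤ A) :
    ∃ β₀ : ℝ, 2 ≤ β₀ ∧ ∀ β : ℝ, β₀ ≤ β → ∃ C : ℝ, 0 < C ∧
      ∀ θ u X : ℝ, 0 < θ → 0 < u → β ≤ u * θ → 1 < X → ∀ v q : ℕ, 2 ∣ v * q →
        |(∑ d₁ ∈ (primesProdBelow (X ^ (1 / u))).divisors,
            ∑ d₂ ∈ (primesProdBelow (X ^ (1 / u))).divisors,
              if d₂.Coprime (d₁ * v) ∧ (d₁ * d₂).Coprime q then
                (μ d₁ : ℝ) * ind 1 β (X ^ θ) d₁ * ((μ d₂ : ℝ) * ind 1 β (X ^ θ) d₂) / ((d₁ : ℝ) * d₂)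
              else 0) -
            (∏ p ∈ (Nat.primesBelow ⌈X ^ (1 / u)⌉₊).filter (fun p => ¬ p ∣ q), (1 - 1 / (p : ℝ))) *
              ∏ p ∈ (Nat.primesBelow ⌈X ^ (1 / u)⌉₊).filter (fun p => ¬ p ∣ v * q),
                (1 - 1 / ((p : ℝ) - 1))| ≤
          C * Real.exp (-(A : ℝ) * θ * u / 2) *
            ((∏ p ∈ (Nat.primesBelow ⌈X ^ (1 / u)⌉₊).filter (fun p => ¬ p ∣ q), (1 - 1 / (p : ℝ))) *
              ∏ p ∈ (Nat.primesBelow ⌈X ^ (1 / u)⌉₊).filter (fun p => ¬ p ∣ v * q),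
                (1 - 1 / ((p : ℝ) - 1))) := by
  have hA0 : (0 : ℝ) < A := by exact_mod_cast hA
  refine ⟨2 + 6 * ((6 : ℝ) + 2 ^ (A + 2)) / A, by
    have : (0 : ℝ) ≤ 6 * ((6 : ℝ) + 2 ^ (A + 2)) / A := by positivity
    linarith, fun β hβA => ?_⟩
  have hβ : 1 < β := by
    have : (0 : ℝ) ≤ 6 * ((6 : ℝ) + 2 ^ (A + 2)) / A := by positivity
    linarith
  refine ⟨3 * Real.exp (24 * ((6 : ℝ) + 2 ^ (A + 1))) * Real.exp ((A : ℝ) * β / 2) +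
      3 * (1 + 3 * Real.exp (24 * ((6 : ℝ) + 2 ^ (A + 1))) * Real.exp ((A : ℝ) * β / 2)) *
        Real.exp 3 * Real.exp (24 * ((6 : ℝ) + 2 ^ (A + 2))) * Real.exp ((A : ℝ) * β / 2),
    by positivity, fun θ u X hθ hu hβu hX v q hvq => ?_⟩
  have hX0 : 0 < X := by linarith
  have hz : 1 < X ^ (1 / u) := Real.one_lt_rpow hX (by positivity)
  have hD1 : 1 < X ^ θ := Real.one_lt_rpow hX hθ
  have hlogz : Real.log (X ^ (1 / u)) = 1 / u * Real.log X := Real.log_rpow hX0 _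
  have hlogD : Real.log (X ^ θ) = θ * Real.log X := Real.log_rpow hX0 _
  have hzD : β * Real.log (X ^ (1 / u)) ≤ Real.log (X ^ θ) := by
    rw [hlogz, hlogD]
    have hlogX : 0 < Real.log X := Real.log_pos hX
    have : β * (1 / u) ≤ θ := by
      rw [mul_one_div, div_le_iff₀ hu]; linarith [mul_comm u θ]
    nlinarith
  have hratio : Real.log (X ^ θ) / Real.log (X ^ (1 / u)) = θ * u := by
    have hlogX : 0 < Real.log X := Real.log_pos hX
    rw [hlogz, hlogD]; field_simp
  set P : ℕ := primesProdBelow (X ^ (1 / u)) with hPdef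
  have hP : Squarefree P := squarefree_primesProdBelow _
  have hPf : P.primeFactors = Nat.primesBelow ⌈X ^ (1 / u)⌉₊ := primeFactors_primesProdBelow _
  have hPz : ∀ p ∈ P.primeFactors, (p : ℝ) < X ^ (1 / u) := by
    intro p hp
    rw [hPf, Nat.mem_primesBelow] at hp
    exact Nat.lt_ceil.mp hp.1
  have h2 : 2 ∈ P.primeFactors → 2 ∣ v * q := fun _ => hvq
  have hmain := abs_compositeSieveSum_sub_le hP hβ hz hD1 hzD hPz h2 hA hβA
  rw [hratio, hPf] at hmain
  convert hmain using 3
  rw [show -(A : ℝ) * θ * u / 2 = -(A : ℝ) * (θ * u) / 2 by ring]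

end Literature.Barriers.Parity
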